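import Literature.NumberTheory.Transcendental.MasserLemma24Points
import HarnessLib

/-!
# Masser 1975, Lemma 2.4 (the Main Lemma)

Support for the book's own proof (Ch. II) of
`Literature.NumberTheory.Transcendental.masser_ellipticPeriods` (Masser 1975, Theorem II);
conclusion of `MasserLemma24Prelim.lean` / `MasserLemma24Points.lean`.

`masser_lemma_2_4`: for a lattice with algebraic invariants and without complex multiplication,
`β₂ ≠ 0` and `β̄₁ω₁ + β̄₂ω₂ ≠ 0`, there are `C` and `N₀` such that for `N ≥ N₀` every polynomial
`φ(z) = ∑_{λ ≤ N} p(λ₀,λ₁,λ₂) f^{λ₀} ℘(ω₁z)^{λ₁} ℘(ω₂z)^{λ₂}`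
(`f = β₁(ζ(ω₁z) - η₁z) + β₂(ζ(ω₂z) - η₂z)`) with `|φ| ≤ M` on `ξ ∩ {|z| ≤ exp((log N)^{36})}` has
`|p(λ)| ≤ (C N)^{20N} M` (Masser: `(c₁₂L)^{c₁₃L} M(c₁₄ e^{(log L)^{36}})`; we take `β₂ ≠ 0`, which
the book assumes "without loss of generality", as a hypothesis — Theorem II is symmetric in the
two periods).

The file has four parts.
1. Values at the points and the grid: Masser's function `f` (`fβ`) and the polynomial `φ`
   (`φ24`), the value `f(z(r₀,r₁,r₂)) = K + r₀Δ` with its error term ((24)–(26)), the boundedness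
   of `gᵢ` on the disc, the normalised coordinates `ξᵢ` and the rounding used to check the
   hypothesis of Lemma 2.3.
2. The core (`PtData.coeff_bound_core`): granted the geometric facts about the points
   `z(r₀,r₁,r₂)`, the bound `|φ| ≤ M` there and the closeness of the normalised coordinates `ξₖ`
   to `rₖ/N³`, the coefficients satisfy `|p| ≤ 2(4N)^{3N} (N+1)³ 2(4N)^{3N} X^{3N} M`: Masser's
   change of variables `Q(x₀,x₁,x₂) = ∑ p (b₀x₀)^{λ₀}(a₁+b₁x₁)^{λ₁}(a₂+b₂x₂)^{λ₂}` followed by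
   Lemma 2.3 for `Q`; instead of inverting the substitution coefficientwise we apply Lemma 2.3 a
   second time, to `P(y) = Q(y₀/b₀, (y₁-a₁)/b₁, (y₂-a₂)/b₂)` on the real cube.
3. Assembly (`PtData.coeff_bound_of_hyps`): for data `(A,B,C)`, `(D,E,F)`, `N` satisfying the
   finitely many explicit inequalities that Masser derives from Lemma 2.2 for large `L`, the
   hypotheses of the core hold.
4. The two triples from Lemma 2.2 at `X = N^{10}` and `X = exp((log N)^{33})`
   (`masser_lemma_2_2`), the verification of the numerical hypotheses for `log N` large
   (`PtData.coeff_bound_of_data`, split into real-variable lemmas), and `masser_lemma_2_4`.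

Everything here is proved; no named facts.

## References

* D. W. Masser, *Elliptic Functions and Transcendence*, Lecture Notes in Math. 437, Springer 1975,
  Ch. II §2.3, Lemma 2.4 and its proof (pp. 19–21). [Masser1975]
-/

noncomputable section

open Complex Metric Set Real Filter Finset
open scoped PeriodPair

namespace Literature.NumberTheory.Transcendental.Masser1975

/-! ## Part 1 (was `MasserLemma24Values`): values at the points and the grid -/

section
variable (L : PeriodPair)

/-- Masser's `f(z) = β₁(ζ(ω₁z) - η₁z) + β₂(ζ(ω₂z) - η₂z)`. [cite: Masser1975, Lemma 2.4] -/
def fβ (β₁ β₂ : ℂ) (z : ℂ) : ℂ := β₁ * gq L 0 z + β₂ * gq L 1 z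

/-- The polynomial `φ(z) = ∑ p(λ₀,λ₁,λ₂) f^{λ₀} ℘(ω₁z)^{λ₁} ℘(ω₂z)^{λ₂}` of Lemma 2.4 (as `triEval`,
`p i j l ↔ f^i ℘(ω₁z)^j ℘(ω₂z)^l`). [cite: Masser1975, Lemma 2.4] -/
def φ24 (β₁ β₂ : ℂ) (N : ℕ) (p : ℕ → ℕ → ℕ → ℂ) (z : ℂ) : ℂ :=
  triEval N p (fβ L β₁ β₂ z) (scaledP L 0 z) (scaledP L 1 z)

/-- **`gᵢ` is bounded on the disc `𝒟`** (continuity of `ζ` off the lattice). [folklore] -/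
theorem exists_bound_gq (d : DiscData L) (i : Fin 2) : ∃ G : ℝ, 0 ≤ G ∧ ∀ z ∈ closedBall (1 / 4 : ℂ) d.ρ, ‖gq L i z‖ ≤ G := by
  have hcont : ContinuousOn (gq L i) (closedBall (1 / 4 : ℂ) d.ρ) := by
    intro z hz
    have hreg : L.basis i * z ∉ L.lattice := d.regular i z hz
    have h1 : ContinuousAt (fun w => L.weierstrassZeta (L.basis i * w)) z := by
      have hd : DifferentiableAt ℂ L.weierstrassZeta (L.basis i * z) :=
        (L.differentiableOn_weierstrassZeta_holds _ hreg).differentiableAt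
          (L.isClosed_lattice.isOpen_compl.mem_nhds hreg)
      exact hd.continuousAt.comp (continuousAt_const.mul continuousAt_id)
    have h2 : ContinuousAt (fun w => L.quasiPeriod i * w) z := continuousAt_const.mul continuousAt_id
    exact (h1.sub h2).continuousWithinAt
  obtain ⟨B, hB⟩ := (isCompact_closedBall _ _).exists_bound_of_continuousOn hcont
  exact ⟨max 0 B, le_max_left _ _, fun z hz => (hB z hz).trans (le_max_right _ _)⟩

/-- `aᵢ = ℘(ωᵢ/4)`. [cite: Masser1975, §2.3 (aᵢ)] -/
def aq (i : Fin 2) : ℂ := scaledP L i (1 / 4)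

namespace PtData

variable {L} (T : PtData L)

/-- The constant part `K = β₁g₁(z(r₁)) + β₂g₂(z') - mκ(β₁C/ω₁ + β₂A/ω₂)` of `f(z(r₀,r₁,r₂))`. [cite: Masser1975, §2.3 (26)] -/
def Kf (β₁ β₂ : ℂ) (r₀ r₁ r₂ : ℤ) : ℂ :=
  β₁ * gq L 0 (T.wpt r₁) + β₂ * gq L 1 (T.w'pt r₀ r₁ r₂) -
    (T.mOf r₁ r₂ : ℂ) * κL L * (β₁ * T.C / L.ω₁ + β₂ * T.A / L.ω₂)

/-- `Δ = -κ(β₁F/ω₁ + β₂D/ω₂)`. [cite: Masser1975, §2.3 (Δ)] -/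
def Δ (β₁ β₂ : ℂ) : ℂ := -κL L * (β₁ * T.F / L.ω₁ + β₂ * T.D / L.ω₂)

/-- **(26), exact form**: `f(z(r₀,r₁,r₂)) = K + r₀Δ`. [cite: Masser1975, §2.3 eq. (26)] -/
theorem fβ_Zpt (β₁ β₂ : ℂ) (r₀ r₁ r₂ : ℤ) :
    fβ L β₁ β₂ (T.Zpt r₀ r₁ r₂) = T.Kf β₁ β₂ r₀ r₁ r₂ + (r₀ : ℂ) * T.Δ β₁ β₂ := by
  unfold fβ Zpt Mint Kf Δ w'pt shift δ ε
  exact fβ_add_int_mul_tau L β₁ β₂ (T.wpt r₁) T.A T.B T.C T.D T.E T.F (T.mOf r₁ r₂) r₀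

/-- **(26), the bound**: `‖f(z(r₀,r₁,r₂)) - r₀Δ‖ ≤ (‖β₁‖+‖β₂‖) G + |m| 2π (‖β₁‖|C|/|ω₁| + ‖β₂‖|A|/|ω₂|)`
when `z(r₁), z' ∈ 𝒟` and `‖gᵢ‖ ≤ G` on `𝒟`. [cite: Masser1975, §2.3 ("|f(z(r₀,r₁,r₂)) - r₀Δ| < c₁₇(1 + |mA| + |mC|)")] -/
theorem norm_fβ_Zpt_sub_le (β₁ β₂ : ℂ) {G : ℝ} (hG : ∀ i : Fin 2, ∀ z ∈ closedBall (1 / 4 : ℂ) T.d.ρ, ‖gq L i z‖ ≤ G)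
    (r₀ r₁ r₂ : ℤ) (h1 : T.wpt r₁ ∈ closedBall (1 / 4 : ℂ) T.d.ρ) (h2 : T.w'pt r₀ r₁ r₂ ∈ closedBall (1 / 4 : ℂ) T.d.ρ) :
    ‖fβ L β₁ β₂ (T.Zpt r₀ r₁ r₂) - (r₀ : ℂ) * T.Δ β₁ β₂‖ ≤
      (‖β₁‖ + ‖β₂‖) * G + |(T.mOf r₁ r₂ : ℝ)| * (2 * Real.pi) *
        (‖β₁‖ * |(T.C : ℝ)| / ‖L.ω₁‖ + ‖β₂‖ * |(T.A : ℝ)| / ‖L.ω₂‖) := by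
  rw [fβ_Zpt, add_sub_cancel_right]
  unfold Kf
  have e1 : ‖β₁ * gq L 0 (T.wpt r₁)‖ ≤ ‖β₁‖ * G := by
    rw [norm_mul]; exact mul_le_mul_of_nonneg_left (hG 0 _ h1) (norm_nonneg _)
  have e2 : ‖β₂ * gq L 1 (T.w'pt r₀ r₁ r₂)‖ ≤ ‖β₂‖ * G := by
    rw [norm_mul]; exact mul_le_mul_of_nonneg_left (hG 1 _ h2) (norm_nonneg _)
  have e3 : ‖(T.mOf r₁ r₂ : ℂ) * κL L * (β₁ * T.C / L.ω₁ + β₂ * T.A / L.ω₂)‖ ≤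
      |(T.mOf r₁ r₂ : ℝ)| * (2 * Real.pi) * (‖β₁‖ * |(T.C : ℝ)| / ‖L.ω₁‖ + ‖β₂‖ * |(T.A : ℝ)| / ‖L.ω₂‖) := by
    rw [norm_mul, norm_mul, Complex.norm_intCast, norm_κL]
    refine mul_le_mul_of_nonneg_left ?_ (by positivity)
    refine (norm_add_le _ _).trans (le_of_eq ?_)
    rw [norm_div, norm_div, norm_mul, norm_mul, Complex.norm_intCast, Complex.norm_intCast]
  calc _ ≤ ‖β₁ * gq L 0 (T.wpt r₁) + β₂ * gq L 1 (T.w'pt r₀ r₁ r₂)‖ +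
        ‖(T.mOf r₁ r₂ : ℂ) * κL L * (β₁ * T.C / L.ω₁ + β₂ * T.A / L.ω₂)‖ := norm_sub_le _ _
    _ ≤ (‖β₁‖ * G + ‖β₂‖ * G) + _ := add_le_add ((norm_add_le _ _).trans (add_le_add e1 e2)) e3
    _ = _ := by ring

/-! ### The normalised coordinates -/

/-- `bᵢ = θ ωᵢ ℘'(ωᵢ/4)/(ω₁ω₂N⁴)`. [cite: Masser1975, §2.3 (bᵢ)] -/
def bC (i : Fin 2) : ℂ := T.θ * (L.basis i * ℘'[L] (L.basis i / 4)) / (L.ω₁ * L.ω₂ * (T.N : ℂ) ^ 4)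

/-- `bᵢ ≠ 0`. [folklore] -/
theorem bC_ne_zero (i : Fin 2) : T.bC i ≠ 0 := by
  unfold bC
  have hθ : T.θ ≠ 0 := by
    intro h; have := T.norm_θ; rw [h, norm_zero] at this; exact zero_ne_one this
  have hN : (T.N : ℂ) ≠ 0 := by exact_mod_cast (Nat.pos_iff_ne_zero.mp T.hN)
  have h℘' := derivWeierstrassP_basis_div_four_ne_zero L i
  exact div_ne_zero (mul_ne_zero hθ (mul_ne_zero (basis_ne_zero L i) h℘'))
    (mul_ne_zero (mul_ne_zero ω₁_ne ω₂_ne) (pow_ne_zero _ hN))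

/-- `‖bᵢ‖ = ‖ωᵢ℘'(ωᵢ/4)‖/(|ω₁ω₂| N⁴)`. [folklore] -/
theorem norm_bC (i : Fin 2) : ‖T.bC i‖ = ‖L.basis i * ℘'[L] (L.basis i / 4)‖ / (‖L.ω₁ * L.ω₂‖ * (T.N : ℝ) ^ 4) := by
  unfold bC
  rw [norm_div, norm_mul, T.norm_θ, one_mul, norm_mul (L.ω₁ * L.ω₂) ((T.N : ℂ) ^ 4), norm_pow, Complex.norm_natCast]

/-- `bᵢ r/N³ = ωᵢ℘'(ωᵢ/4) · (θ r/(ω₁ω₂N⁷))`: the linear term of the Taylor expansion at the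
displacement `uᵢ(r) = z(r) - ¼`. [folklore] -/
theorem bC_mul_div (i : Fin 2) (r : ℤ) :
    T.bC i * r / (T.N : ℂ) ^ 3 = (L.basis i * ℘'[L] (L.basis i / 4)) * (T.wpt r - 1 / 4) := by
  unfold bC wpt
  have hN : (T.N : ℂ) ≠ 0 := by exact_mod_cast (Nat.pos_iff_ne_zero.mp T.hN)
  field_simp
  ring

/-- **Taylor at the points**: `‖℘(ωᵢ z(r)) - aᵢ - bᵢ r/N³‖ ≤ Cᵢ ‖z(r) - ¼‖²` (`z(r) ∈ 𝒟`).
[cite: Masser1975, §2.3 ("|xᵢ(rᵢ) - aᵢ - bᵢrᵢ/L³| < c₂₁ L^{-8}")] -/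
theorem norm_scaledP_wpt_sub_le (i : Fin 2) {Cᵢ : ℝ}
    (hC : ∀ u : ℂ, ‖u‖ ≤ T.d.ρ → ‖scaledP L i (1 / 4 + u) - scaledP L i (1 / 4) -
      (L.basis i * ℘'[L] (L.basis i / 4)) * u‖ ≤ Cᵢ * ‖u‖ ^ 2)
    (r : ℤ) (hr : ‖T.wpt r - 1 / 4‖ ≤ T.d.ρ) :
    ‖scaledP L i (T.wpt r) - aq L i - T.bC i * r / (T.N : ℂ) ^ 3‖ ≤ Cᵢ * ‖T.wpt r - 1 / 4‖ ^ 2 := by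
  have h := hC (T.wpt r - 1 / 4) hr
  rw [add_sub_cancel] at h
  rw [bC_mul_div]
  exact h

/-- The coordinate `ξ = (x - a)/b` is close to `r/N³` when `x` is close to `a + b r/N³`. [folklore] -/
theorem norm_coord_sub_le {x a b : ℂ} (hb : b ≠ 0) {r : ℤ} {N : ℕ} {η : ℝ}
    (h : ‖x - a - b * r / (N : ℂ) ^ 3‖ ≤ η) : ‖(x - a) / b - (r : ℂ) / (N : ℂ) ^ 3‖ ≤ η / ‖b‖ := by
  have : (x - a) / b - (r : ℂ) / (N : ℂ) ^ 3 = (x - a - b * r / (N : ℂ) ^ 3) / b := by field_simp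
  rw [this, norm_div]
  exact div_le_div_of_nonneg_right h (norm_nonneg _)

/-! ### Rounding to the grid -/

/-- For real `|y| ≤ 1` and `N ≥ 1`, the integer `r = round(y N³)` has `|r| ≤ N³` and
`|y - r/N³| ≤ 1/(2N³)`. [cite: Masser1975, §2.3 ("there are integers r₀, r₁, r₂ with absolute values at most L³ such that |ηᵢ - rᵢ/L³| < 1/2L³")] -/
theorem round_grid {y : ℝ} (hy : |y| ≤ 1) {N : ℕ} (hN : 1 ≤ N) :
    |round (y * (N : ℝ) ^ 3)| ≤ (N : ℤ) ^ 3 ∧ |y - (round (y * (N : ℝ) ^ 3) : ℝ) / (N : ℝ) ^ 3| ≤ 1 / (2 * (N : ℝ) ^ 3) := by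
  have hN0 : (0 : ℝ) < (N : ℝ) ^ 3 := by positivity
  constructor
  · rw [abs_le, round_eq]
    obtain ⟨hy1, hy2⟩ := abs_le.mp hy
    constructor
    · rw [Int.le_floor]; push_cast; nlinarith
    · have h1 : y * (N : ℝ) ^ 3 + 1 / 2 ≤ (((N : ℤ) ^ 3 : ℤ) : ℝ) + 1 / 2 := by push_cast; nlinarith
      have h2 := Int.floor_le_floor h1
      rw [Int.floor_intCast_add] at h2
      norm_num at h2
      exact h2
  · have h := abs_sub_round (y * (N : ℝ) ^ 3)
    have e : y - (round (y * (N : ℝ) ^ 3) : ℝ) / (N : ℝ) ^ 3 = (y * (N : ℝ) ^ 3 - round (y * (N : ℝ) ^ 3)) / (N : ℝ) ^ 3 := by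
      field_simp
    rw [e, abs_div, abs_of_pos hN0, div_le_div_iff₀ hN0 (by positivity)]
    nlinarith

end PtData

end

/-! ## Part 2 (was `MasserLemma24Core`): the core, two applications of Lemma 2.3 -/

section
namespace PtData

variable {L : PeriodPair} (T : PtData L)

/-- The normalised coordinates `(ξ₀, ξ₁, ξ₂)` of the point `z(r₀,r₁,r₂)`:
`b₀ξ₀ = f(z)`, `aᵢ + bᵢξᵢ = ℘(ωᵢz)`. [cite: Masser1975, §2.3 (ξ₀, ξ₁, ξ₂)] -/
def ξpt (β₁ β₂ : ℂ) (r₀ r₁ r₂ : ℤ) : ℂ × ℂ × ℂ :=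
  (fβ L β₁ β₂ (T.Zpt r₀ r₁ r₂) / ((T.N : ℂ) ^ 3 * T.Δ β₁ β₂),
    (scaledP L 0 (T.Zpt r₀ r₁ r₂) - aq L 0) / T.bC 0,
    (scaledP L 1 (T.Zpt r₀ r₁ r₂) - aq L 1) / T.bC 1)

/-- **The core of Lemma 2.4.** [cite: Masser1975, §2.3 (end of the proof of Lemma 2.4)] -/
theorem coeff_bound_core (β₁ β₂ : ℂ) (p : ℕ → ℕ → ℕ → ℂ) {M η X : ℝ} (hM0 : 0 ≤ M) (hX : 1 ≤ X)
    (hΔ : T.Δ β₁ β₂ ≠ 0)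
    (hMpt : ∀ r₀ r₁ r₂ : ℤ, |r₀| ≤ (T.N : ℤ) ^ 3 → |r₁| ≤ (T.N : ℤ) ^ 3 → |r₂| ≤ (T.N : ℤ) ^ 3 →
      ‖φ24 L β₁ β₂ T.N p (T.Zpt r₀ r₁ r₂)‖ ≤ M)
    (hξ : ∀ r₀ r₁ r₂ : ℤ, |r₀| ≤ (T.N : ℤ) ^ 3 → |r₁| ≤ (T.N : ℤ) ^ 3 → |r₂| ≤ (T.N : ℤ) ^ 3 →
      ‖(T.ξpt β₁ β₂ r₀ r₁ r₂).1 - (r₀ : ℂ) / (T.N : ℂ) ^ 3‖ ≤ η ∧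
      ‖(T.ξpt β₁ β₂ r₀ r₁ r₂).2.1 - (r₁ : ℂ) / (T.N : ℂ) ^ 3‖ ≤ η ∧
      ‖(T.ξpt β₁ β₂ r₀ r₁ r₂).2.2 - (r₂ : ℂ) / (T.N : ℂ) ^ 3‖ ≤ η)
    (hη : η + 1 / (2 * (T.N : ℝ) ^ 3) ≤ (21 * (T.N : ℝ) ^ 2)⁻¹)
    (hXb : ∀ y : ℝ, |y| ≤ 1 → ‖(y : ℂ) / ((T.N : ℂ) ^ 3 * T.Δ β₁ β₂)‖ ≤ X ∧
      ‖((y : ℂ) - aq L 0) / T.bC 0‖ ≤ X ∧ ‖((y : ℂ) - aq L 1) / T.bC 1‖ ≤ X)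
    {i j l : ℕ} (hi : i ≤ T.N) (hj : j ≤ T.N) (hl : l ≤ T.N) :
    ‖p i j l‖ ≤ 2 * (4 * T.N) ^ (3 * T.N) *
      (((T.N : ℝ) + 1) ^ 3 * (2 * (4 * T.N) ^ (3 * T.N) * M) * X ^ (3 * T.N)) := by
  set N := T.N with hNdef
  have hN := T.hN
  set b₀ : ℂ := (T.N : ℂ) ^ 3 * T.Δ β₁ β₂ with hb₀def
  have hb₀0 : b₀ ≠ 0 := mul_ne_zero (pow_ne_zero _ (by exact_mod_cast (Nat.pos_iff_ne_zero.mp hN))) hΔ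
  have hb1 := T.bC_ne_zero 0
  have hb2 := T.bC_ne_zero 1
  -- the substituted polynomial `Q`
  set Q := subQ N p 0 b₀ (aq L 0) (T.bC 0) (aq L 1) (T.bC 1) with hQ
  -- Step 1: `Q(ξ) = φ(z)` at the points, hence `|Q| ≤ M` on the point set
  set 𝒮 : Set (ℂ × ℂ × ℂ) := {s | ∃ r₀ r₁ r₂ : ℤ, |r₀| ≤ (N : ℤ) ^ 3 ∧ |r₁| ≤ (N : ℤ) ^ 3 ∧ |r₂| ≤ (N : ℤ) ^ 3 ∧
    s = T.ξpt β₁ β₂ r₀ r₁ r₂} with h𝒮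
  have hQval : ∀ r₀ r₁ r₂ : ℤ, triEval N Q (T.ξpt β₁ β₂ r₀ r₁ r₂).1 (T.ξpt β₁ β₂ r₀ r₁ r₂).2.1
      (T.ξpt β₁ β₂ r₀ r₁ r₂).2.2 = φ24 L β₁ β₂ N p (T.Zpt r₀ r₁ r₂) := by
    intro r₀ r₁ r₂
    rw [hQ, triEval_subQ, φ24, triEval_eq_sum]
    refine Finset.sum_congr rfl fun i _ => Finset.sum_congr rfl fun j _ => Finset.sum_congr rfl fun l _ => ?_
    simp only [ξpt]
    have e0 : (0 : ℂ) + b₀ * (fβ L β₁ β₂ (T.Zpt r₀ r₁ r₂) / ((T.N : ℂ) ^ 3 * T.Δ β₁ β₂)) = fβ L β₁ β₂ (T.Zpt r₀ r₁ r₂) := by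
      rw [hb₀def, zero_add, mul_div_cancel₀ _ hb₀0]
    have e1 : aq L 0 + T.bC 0 * ((scaledP L 0 (T.Zpt r₀ r₁ r₂) - aq L 0) / T.bC 0) = scaledP L 0 (T.Zpt r₀ r₁ r₂) := by
      rw [mul_div_cancel₀ _ hb1]; ring
    have e2 : aq L 1 + T.bC 1 * ((scaledP L 1 (T.Zpt r₀ r₁ r₂) - aq L 1) / T.bC 1) = scaledP L 1 (T.Zpt r₀ r₁ r₂) := by
      rw [mul_div_cancel₀ _ hb2]; ring
    rw [e0, e1, e2]
  have hM𝒮 : ∀ s ∈ 𝒮, ‖triEval N Q s.1 s.2.1 s.2.2‖ ≤ M := by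
    rintro s ⟨r₀, r₁, r₂, h0, h1, h2, rfl⟩
    rw [hQval]; exact hMpt r₀ r₁ r₂ h0 h1 h2
  -- the grid hypothesis for `𝒮`
  have hN1 : (1 : ℝ) ≤ N := by exact_mod_cast hN
  have hgrid : ∀ x₁ x₂ x₃ : ℝ, |x₁| ≤ 1 → |x₂| ≤ 1 → |x₃| ≤ 1 → ∃ s ∈ 𝒮,
      ‖s.1 - x₁‖ ≤ (21 * (N : ℝ) ^ 2)⁻¹ ∧ ‖s.2.1 - x₂‖ ≤ (21 * (N : ℝ) ^ 2)⁻¹ ∧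
        ‖s.2.2 - x₃‖ ≤ (21 * (N : ℝ) ^ 2)⁻¹ := by
    intro x₁ x₂ x₃ hx₁ hx₂ hx₃
    obtain ⟨hr₀, hy₀⟩ := round_grid hx₁ hN
    obtain ⟨hr₁, hy₁⟩ := round_grid hx₂ hN
    obtain ⟨hr₂, hy₂⟩ := round_grid hx₃ hN
    set r₀ := round (x₁ * (N : ℝ) ^ 3)
    set r₁ := round (x₂ * (N : ℝ) ^ 3)
    set r₂ := round (x₃ * (N : ℝ) ^ 3)
    obtain ⟨e0, e1, e2⟩ := hξ r₀ r₁ r₂ hr₀ hr₁ hr₂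
    refine ⟨T.ξpt β₁ β₂ r₀ r₁ r₂, ⟨r₀, r₁, r₂, hr₀, hr₁, hr₂, rfl⟩, ?_, ?_, ?_⟩
    · -- `‖ξ₀ - x₁‖ ≤ ‖ξ₀ - r₀/N³‖ + |r₀/N³ - x₁|`
      have hreal : ‖((r₀ : ℂ) / (T.N : ℂ) ^ 3) - (x₁ : ℂ)‖ ≤ 1 / (2 * (N : ℝ) ^ 3) := by
        rw [show ((r₀ : ℂ) / (T.N : ℂ) ^ 3) - (x₁ : ℂ) = (((r₀ : ℝ) / (N : ℝ) ^ 3 - x₁ : ℝ) : ℂ) by push_cast; rfl,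
          Complex.norm_real, Real.norm_eq_abs, abs_sub_comm]
        exact hy₀
      calc ‖(T.ξpt β₁ β₂ r₀ r₁ r₂).1 - x₁‖ ≤ ‖(T.ξpt β₁ β₂ r₀ r₁ r₂).1 - (r₀ : ℂ) / (T.N : ℂ) ^ 3‖ +
            ‖((r₀ : ℂ) / (T.N : ℂ) ^ 3) - (x₁ : ℂ)‖ := norm_sub_le_norm_sub_add_norm_sub _ _ _
        _ ≤ η + 1 / (2 * (N : ℝ) ^ 3) := add_le_add e0 hreal
        _ ≤ _ := hη
    · have hreal : ‖((r₁ : ℂ) / (T.N : ℂ) ^ 3) - (x₂ : ℂ)‖ ≤ 1 / (2 * (N : ℝ) ^ 3) := by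
        rw [show ((r₁ : ℂ) / (T.N : ℂ) ^ 3) - (x₂ : ℂ) = (((r₁ : ℝ) / (N : ℝ) ^ 3 - x₂ : ℝ) : ℂ) by push_cast; rfl,
          Complex.norm_real, Real.norm_eq_abs, abs_sub_comm]
        exact hy₁
      calc ‖(T.ξpt β₁ β₂ r₀ r₁ r₂).2.1 - x₂‖ ≤ ‖(T.ξpt β₁ β₂ r₀ r₁ r₂).2.1 - (r₁ : ℂ) / (T.N : ℂ) ^ 3‖ +
            ‖((r₁ : ℂ) / (T.N : ℂ) ^ 3) - (x₂ : ℂ)‖ := norm_sub_le_norm_sub_add_norm_sub _ _ _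
        _ ≤ η + 1 / (2 * (N : ℝ) ^ 3) := add_le_add e1 hreal
        _ ≤ _ := hη
    · have hreal : ‖((r₂ : ℂ) / (T.N : ℂ) ^ 3) - (x₃ : ℂ)‖ ≤ 1 / (2 * (N : ℝ) ^ 3) := by
        rw [show ((r₂ : ℂ) / (T.N : ℂ) ^ 3) - (x₃ : ℂ) = (((r₂ : ℝ) / (N : ℝ) ^ 3 - x₃ : ℝ) : ℂ) by push_cast; rfl,
          Complex.norm_real, Real.norm_eq_abs, abs_sub_comm]
        exact hy₂
      calc ‖(T.ξpt β₁ β₂ r₀ r₁ r₂).2.2 - x₃‖ ≤ ‖(T.ξpt β₁ β₂ r₀ r₁ r₂).2.2 - (r₂ : ℂ) / (T.N : ℂ) ^ 3‖ +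
            ‖((r₂ : ℂ) / (T.N : ℂ) ^ 3) - (x₃ : ℂ)‖ := norm_sub_le_norm_sub_add_norm_sub _ _ _
        _ ≤ η + 1 / (2 * (N : ℝ) ^ 3) := add_le_add e2 hreal
        _ ≤ _ := hη
  -- Lemma 2.3 for `Q`
  have hQbound : ∀ μ₁ μ₂ μ₃ : ℕ, μ₁ ≤ N → μ₂ ≤ N → μ₃ ≤ N → ‖Q μ₁ μ₂ μ₃‖ ≤ 2 * (4 * N) ^ (3 * N) * M :=
    fun μ₁ μ₂ μ₃ h₁ h₂ h₃ => masser_lemma_2_3 hN Q 𝒮 hgrid hM𝒮 h₁ h₂ h₃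
  -- Step 2: `P(y) = Q(y₀/b₀, (y₁-a₁)/b₁, (y₂-a₂)/b₂)` on the real cube is bounded
  have hMq0 : 0 ≤ 2 * (4 * (N : ℝ)) ^ (3 * N) * M := by positivity
  set 𝒮' : Set (ℂ × ℂ × ℂ) := {s | ∃ y₁ y₂ y₃ : ℝ, |y₁| ≤ 1 ∧ |y₂| ≤ 1 ∧ |y₃| ≤ 1 ∧
    s = ((y₁ : ℂ), (y₂ : ℂ), (y₃ : ℂ))} with h𝒮'
  have hPval : ∀ y₁ y₂ y₃ : ℂ, triEval N p y₁ y₂ y₃ =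
      triEval N Q (y₁ / b₀) ((y₂ - aq L 0) / T.bC 0) ((y₃ - aq L 1) / T.bC 1) := by
    intro y₁ y₂ y₃
    rw [hQ, triEval_subQ, triEval_eq_sum]
    refine Finset.sum_congr rfl fun i _ => Finset.sum_congr rfl fun j _ => Finset.sum_congr rfl fun l _ => ?_
    have e0 : (0 : ℂ) + b₀ * (y₁ / b₀) = y₁ := by rw [zero_add, mul_div_cancel₀ _ hb₀0]
    have e1 : aq L 0 + T.bC 0 * ((y₂ - aq L 0) / T.bC 0) = y₂ := by rw [mul_div_cancel₀ _ hb1]; ring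
    have e2 : aq L 1 + T.bC 1 * ((y₃ - aq L 1) / T.bC 1) = y₃ := by rw [mul_div_cancel₀ _ hb2]; ring
    rw [e0, e1, e2]
  have hM' : ∀ s ∈ 𝒮', ‖triEval N p s.1 s.2.1 s.2.2‖ ≤
      ((N : ℝ) + 1) ^ 3 * (2 * (4 * N) ^ (3 * N) * M) * X ^ (3 * N) := by
    rintro s ⟨y₁, y₂, y₃, h₁, h₂, h₃, rfl⟩
    simp only
    rw [hPval]
    obtain ⟨hx₁, -, -⟩ := hXb y₁ h₁
    obtain ⟨-, hx₂, -⟩ := hXb y₂ h₂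
    obtain ⟨-, -, hx₃⟩ := hXb y₃ h₃
    exact norm_triEval_le hMq0 hX hQbound hx₁ hx₂ hx₃
  have hgrid' : ∀ x₁ x₂ x₃ : ℝ, |x₁| ≤ 1 → |x₂| ≤ 1 → |x₃| ≤ 1 → ∃ s ∈ 𝒮',
      ‖s.1 - x₁‖ ≤ (21 * (N : ℝ) ^ 2)⁻¹ ∧ ‖s.2.1 - x₂‖ ≤ (21 * (N : ℝ) ^ 2)⁻¹ ∧
        ‖s.2.2 - x₃‖ ≤ (21 * (N : ℝ) ^ 2)⁻¹ := by
    intro x₁ x₂ x₃ h₁ h₂ h₃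
    refine ⟨((x₁ : ℂ), (x₂ : ℂ), (x₃ : ℂ)), ⟨x₁, x₂, x₃, h₁, h₂, h₃, rfl⟩, ?_, ?_, ?_⟩ <;>
      simp only [sub_self, norm_zero] <;> positivity
  exact masser_lemma_2_3 hN p 𝒮' hgrid' hM' hi hj hl

end PtData

end

/-! ## Part 3 (was `MasserLemma24Assembly`): assembly from the numerical hypotheses -/

section
namespace PtData

variable {L : PeriodPair} (T : PtData L)

/-- The constants of the lattice, the disc and `β₁, β₂` entering the assembly. [cite: Masser1975, §2.3 ("c₁₂, c₁₃ and c₁₄ depend only on β₁, β₂, ω₁ and ω₂")] -/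
structure AsmConsts (L : PeriodPair) (d : DiscData L) (β₁ β₂ : ℂ) where
  /-- Taylor constants at `¼` -/
  Ct : Fin 2 → ℝ
  hCt0 : ∀ i, 0 ≤ Ct i
  hCt : ∀ i, ∀ u : ℂ, ‖u‖ ≤ d.ρ → ‖scaledP L i (1 / 4 + u) - scaledP L i (1 / 4) -
    (L.basis i * ℘'[L] (L.basis i / 4)) * u‖ ≤ Ct i * ‖u‖ ^ 2
  /-- bound for `gᵢ` on `𝒟` -/
  G : ℝ
  hG0 : 0 ≤ G
  hG : ∀ i : Fin 2, ∀ z ∈ closedBall (1 / 4 : ℂ) d.ρ, ‖gq L i z‖ ≤ G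
  /-- Lipschitz constant of `℘(ω₂ ·)` on `𝒟` is non-negative -/
  hc₂ : 0 ≤ d.c₂

/-- The constants exist. [folklore] -/
theorem exists_asmConsts (L : PeriodPair) (d : DiscData L) (β₁ β₂ : ℂ) : Nonempty (AsmConsts L d β₁ β₂) := by
  obtain ⟨C₀, hC₀0, hC₀⟩ := scaledP_taylor_two L d 0
  obtain ⟨C₁, hC₁0, hC₁⟩ := scaledP_taylor_two L d 1
  obtain ⟨G₀, hG₀0, hG₀⟩ := exists_bound_gq L d 0
  obtain ⟨G₁, hG₁0, hG₁⟩ := exists_bound_gq L d 1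
  have hc₂ : 0 ≤ d.c₂ := by
    by_contra hneg
    push Not at hneg
    have hu : (1 / 4 : ℂ) + d.ρ ∈ closedBall (1 / 4 : ℂ) d.ρ := by
      rw [mem_closedBall_iff_norm, add_sub_cancel_left, Complex.norm_real, Real.norm_eq_abs, abs_of_pos d.ρ_pos]
    have h := d.upper 0 _ hu (1 / 4) (mem_closedBall_self d.ρ_pos.le)
    rw [add_sub_cancel_left, Complex.norm_real, Real.norm_eq_abs, abs_of_pos d.ρ_pos] at h
    have : d.c₂ * d.ρ < 0 := mul_neg_of_neg_of_pos hneg d.ρ_pos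
    linarith [norm_nonneg (scaledP L 0 (1 / 4 + d.ρ) - scaledP L 0 (1 / 4))]
  refine ⟨⟨![C₀, C₁], ?_, ?_, max G₀ G₁, le_max_of_le_left hG₀0, ?_, hc₂⟩⟩
  · intro i; fin_cases i <;> simp [hC₀0, hC₁0]
  · intro i; fin_cases i
    · simpa using hC₀
    · simpa using hC₁
  · intro i z hz; fin_cases i
    · exact (hG₀ z hz).trans (le_max_left _ _)
    · exact (hG₁ z hz).trans (le_max_right _ _)

/-- `Cω = |ω₁ω₂| > 0`. [folklore] -/
theorem Cω_pos : 0 < ‖L.ω₁ * L.ω₂‖ := norm_pos_iff.mpr (mul_ne_zero ω₁_ne ω₂_ne)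

/-- `Pᵢ' = ‖ωᵢ℘'(ωᵢ/4)‖ > 0`. [folklore] -/
theorem P'_pos (i : Fin 2) : 0 < ‖L.basis i * ℘'[L] (L.basis i / 4)‖ :=
  norm_pos_iff.mpr (mul_ne_zero (basis_ne_zero L i) (derivWeierstrassP_basis_div_four_ne_zero L i))

/-- The constant of the grid error `η = Kη N⁻⁴`. [folklore] -/
def Kη (d : DiscData L) {β₁ β₂ : ℂ} (K : AsmConsts L d β₁ β₂) : ℝ :=
  max 1 (max (K.Ct 0 / (‖L.ω₁ * L.ω₂‖ * ‖L.basis 0 * ℘'[L] (L.basis 0 / 4)‖))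
    ((2 * d.c₂ + K.Ct 1 / ‖L.ω₁ * L.ω₂‖) / ‖L.basis 1 * ℘'[L] (L.basis 1 / 4)‖))

/-- The constant of the size bound `X = KX N⁴`. [folklore] -/
def KX (L : PeriodPair) : ℝ :=
  max 1 (max ((1 + ‖aq L 0‖) * ‖L.ω₁ * L.ω₂‖ / ‖L.basis 0 * ℘'[L] (L.basis 0 / 4)‖)
    ((1 + ‖aq L 1‖) * ‖L.ω₁ * L.ω₂‖ / ‖L.basis 1 * ℘'[L] (L.basis 1 / 4)‖))

/-- The error bound `Ef` for `f(z(r₀,r₁,r₂)) - r₀Δ` in terms of a bound `mB` for `|m|`. [cite: Masser1975, §2.3 (26)] -/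
def Ef (β₁ β₂ : ℂ) (G mB : ℝ) : ℝ :=
  (‖β₁‖ + ‖β₂‖) * G + mB * (2 * Real.pi) * (‖β₁‖ * |(T.C : ℝ)| / ‖L.ω₁‖ + ‖β₂‖ * |(T.A : ℝ)| / ‖L.ω₂‖)

/-- **Lemma 2.4 from the numerical hypotheses.** [cite: Masser1975, §2.3 (proof of Lemma 2.4)] -/
theorem coeff_bound_of_hyps {β₁ β₂ : ℂ} (K : AsmConsts L T.d β₁ β₂) {mB R M : ℝ} (p : ℕ → ℕ → ℕ → ℂ)
    (hM0 : 0 ≤ M) (hN2 : 2 ≤ T.N)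
    -- the disc
    (hρ : 10 / (‖L.ω₁ * L.ω₂‖ * (T.N : ℝ) ^ 4) ≤ T.d.ρ)
    -- `m`
    (hmB : 2 * ((T.N : ℝ) ^ 4)⁻¹ / ‖T.δ‖ + 1 ≤ mB)
    -- smallness of `δ`, `ε`
    (hshift : mB * ‖T.δ‖ + (T.N : ℝ) ^ 3 * ‖T.ε‖ ≤ 4 * ((T.N : ℝ) ^ 4)⁻¹)
    (hδε : ‖T.δ‖ / 2 + (T.N : ℝ) ^ 3 * ‖T.ε‖ ≤ 2 * ((T.N : ℝ) ^ 8)⁻¹)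
    -- `Δ`
    (hΔ1 : 1 ≤ (T.N : ℝ) ^ 3 * ‖T.Δ β₁ β₂‖) (hΔ2 : T.Ef β₁ β₂ K.G mB * T.N ≤ ‖T.Δ β₁ β₂‖)
    -- the grid
    (hη : Kη T.d K * ((T.N : ℝ) ^ 4)⁻¹ + 1 / (2 * (T.N : ℝ) ^ 3) ≤ (21 * (T.N : ℝ) ^ 2)⁻¹)
    -- the radius
    (hR : 1 + (mB * |(T.C : ℝ)| + (T.N : ℝ) ^ 3 * |(T.F : ℝ)|) * ‖L.ω₂ / L.ω₁‖ ≤ R)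
    -- the bound for `φ` on `ξ ∩ {|z| ≤ R}`
    (hM : ∀ z ∈ xiSet T.d, ‖z‖ ≤ R → ‖φ24 L β₁ β₂ T.N p z‖ ≤ M)
    {i j l : ℕ} (hi : i ≤ T.N) (hj : j ≤ T.N) (hl : l ≤ T.N) :
    ‖p i j l‖ ≤ 2 * (4 * T.N) ^ (3 * T.N) *
      (((T.N : ℝ) + 1) ^ 3 * (2 * (4 * T.N) ^ (3 * T.N) * M) * (KX L * (T.N : ℝ) ^ 4) ^ (3 * T.N)) := by
  have hN := T.hN
  have hNr : (2 : ℝ) ≤ T.N := by exact_mod_cast hN2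
  have hN1 : (1 : ℝ) ≤ T.N := by linarith
  have hN0 : (0 : ℝ) < T.N := by linarith
  have hCω := Cω_pos (L := L)
  have hP0 := P'_pos (L := L) 0
  have hP1 := P'_pos (L := L) 1
  have hρpos := T.d.ρ_pos
  set N4i : ℝ := ((T.N : ℝ) ^ 4)⁻¹ with hN4i
  have hN4i0 : 0 < N4i := by positivity
  -- `Δ ≠ 0`
  have hΔpos : 0 < ‖T.Δ β₁ β₂‖ := by
    by_contra h
    push Not at h
    have : (T.N : ℝ) ^ 3 * ‖T.Δ β₁ β₂‖ ≤ 0 := mul_nonpos_of_nonneg_of_nonpos (by positivity) h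
    linarith
  have hΔ0 : T.Δ β₁ β₂ ≠ 0 := norm_pos_iff.mp hΔpos
  -- the disc radius conditions
  have hρ1 : N4i / ‖L.ω₁ * L.ω₂‖ ≤ T.d.ρ / 10 := by
    rw [div_le_div_iff₀ hCω (by norm_num)]
    have : 10 / (‖L.ω₁ * L.ω₂‖ * (T.N : ℝ) ^ 4) = 10 * N4i / ‖L.ω₁ * L.ω₂‖ := by
      rw [hN4i]; field_simp
    rw [this, div_le_iff₀ hCω] at hρ
    linarith
  -- `z(r) ∈ 𝒟` for `|r| ≤ N³`
  have hw : ∀ r : ℤ, |r| ≤ (T.N : ℤ) ^ 3 → ‖T.wpt r - 1 / 4‖ ≤ N4i / ‖L.ω₁ * L.ω₂‖ := fun r hr =>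
    T.norm_wpt_sub_le hr
  have hwball : ∀ r : ℤ, |r| ≤ (T.N : ℤ) ^ 3 → T.wpt r ∈ closedBall (1 / 4 : ℂ) T.d.ρ := fun r hr => by
    rw [mem_closedBall_iff_norm]; linarith [hw r hr, hρ1]
  -- `|m| ≤ mB`
  have hδ0 : 0 < ‖T.δ‖ := norm_pos_iff.mpr T.hδ
  have hm : ∀ r₁ r₂ : ℤ, |r₁| ≤ (T.N : ℤ) ^ 3 → |r₂| ≤ (T.N : ℤ) ^ 3 → |(T.mOf r₁ r₂ : ℝ)| ≤ mB := by
    intro r₁ r₂ h1 h2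
    refine (T.abs_mOf_le h1 h2).trans (le_trans (le_of_eq ?_) hmB)
    rw [hN4i]; field_simp
  have hmB1 : 1 ≤ mB := by
    have : 0 ≤ 2 * N4i / ‖T.δ‖ := by positivity
    linarith
  -- the shift and `z' ∈ 𝒟`
  have hshift' : ∀ r₀ r₁ r₂ : ℤ, |r₀| ≤ (T.N : ℤ) ^ 3 → |r₁| ≤ (T.N : ℤ) ^ 3 → |r₂| ≤ (T.N : ℤ) ^ 3 →
      ‖T.shift r₀ r₁ r₂‖ ≤ 4 * N4i / ‖L.ω₁ * L.ω₂‖ := by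
    intro r₀ r₁ r₂ h0 h1 h2
    unfold shift
    rw [norm_div]
    refine div_le_div_of_nonneg_right ?_ hCω.le
    have hr₀ : |(r₀ : ℝ)| ≤ (T.N : ℝ) ^ 3 := by exact_mod_cast h0
    calc ‖(T.mOf r₁ r₂ : ℂ) * T.δ + (r₀ : ℂ) * T.ε‖ ≤ ‖(T.mOf r₁ r₂ : ℂ) * T.δ‖ + ‖(r₀ : ℂ) * T.ε‖ := norm_add_le _ _
      _ = |(T.mOf r₁ r₂ : ℝ)| * ‖T.δ‖ + |(r₀ : ℝ)| * ‖T.ε‖ := by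
          rw [norm_mul, norm_mul, Complex.norm_intCast, Complex.norm_intCast]
      _ ≤ mB * ‖T.δ‖ + (T.N : ℝ) ^ 3 * ‖T.ε‖ := add_le_add (mul_le_mul_of_nonneg_right (hm r₁ r₂ h1 h2) (norm_nonneg _))
          (mul_le_mul_of_nonneg_right hr₀ (norm_nonneg _))
      _ ≤ 4 * N4i := hshift
  have hw'ball : ∀ r₀ r₁ r₂ : ℤ, |r₀| ≤ (T.N : ℤ) ^ 3 → |r₁| ≤ (T.N : ℤ) ^ 3 → |r₂| ≤ (T.N : ℤ) ^ 3 →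
      T.w'pt r₀ r₁ r₂ ∈ closedBall (1 / 4 : ℂ) T.d.ρ := by
    intro r₀ r₁ r₂ h0 h1 h2
    rw [mem_closedBall_iff_norm]
    unfold w'pt
    calc ‖T.wpt r₁ + T.shift r₀ r₁ r₂ - 1 / 4‖ = ‖(T.wpt r₁ - 1 / 4) + T.shift r₀ r₁ r₂‖ := by ring_nf
      _ ≤ ‖T.wpt r₁ - 1 / 4‖ + ‖T.shift r₀ r₁ r₂‖ := norm_add_le _ _
      _ ≤ N4i / ‖L.ω₁ * L.ω₂‖ + 4 * N4i / ‖L.ω₁ * L.ω₂‖ := add_le_add (hw r₁ h1) (hshift' r₀ r₁ r₂ h0 h1 h2)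
      _ = 5 * (N4i / ‖L.ω₁ * L.ω₂‖) := by ring
      _ ≤ T.d.ρ := by linarith
  -- the points lie in `ξ` and in `{|z| ≤ R}`
  have hZR : ∀ r₀ r₁ r₂ : ℤ, |r₀| ≤ (T.N : ℤ) ^ 3 → |r₁| ≤ (T.N : ℤ) ^ 3 → |r₂| ≤ (T.N : ℤ) ^ 3 →
      ‖T.Zpt r₀ r₁ r₂‖ ≤ R := by
    intro r₀ r₁ r₂ h0 h1 h2
    unfold Zpt Mint
    have hr₀ : |(r₀ : ℝ)| ≤ (T.N : ℝ) ^ 3 := by exact_mod_cast h0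
    have hwn : ‖T.wpt r₁‖ ≤ 1 := by
      have e : T.wpt r₁ = (T.wpt r₁ - 1 / 4) + 1 / 4 := by ring
      rw [e]
      refine (norm_add_le _ _).trans ?_
      rw [show ‖(1 / 4 : ℂ)‖ = 1 / 4 by norm_num]
      have := T.d.ρ_le
      linarith [hw r₁ h1, hρ1]
    have hMint : ‖((T.mOf r₁ r₂ * T.C + r₀ * T.F : ℤ) : ℂ)‖ ≤ mB * |(T.C : ℝ)| + (T.N : ℝ) ^ 3 * |(T.F : ℝ)| := by
      rw [Complex.norm_intCast]
      push_cast
      calc |(T.mOf r₁ r₂ : ℝ) * T.C + r₀ * T.F| ≤ |(T.mOf r₁ r₂ : ℝ) * T.C| + |(r₀ : ℝ) * T.F| := abs_add_le _ _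
        _ = |(T.mOf r₁ r₂ : ℝ)| * |(T.C : ℝ)| + |(r₀ : ℝ)| * |(T.F : ℝ)| := by rw [abs_mul, abs_mul]
        _ ≤ mB * |(T.C : ℝ)| + (T.N : ℝ) ^ 3 * |(T.F : ℝ)| := add_le_add
            (mul_le_mul_of_nonneg_right (hm r₁ r₂ h1 h2) (abs_nonneg _)) (mul_le_mul_of_nonneg_right hr₀ (abs_nonneg _))
    calc ‖T.wpt r₁ + ((T.mOf r₁ r₂ * T.C + r₀ * T.F : ℤ) : ℂ) * (L.ω₂ / L.ω₁)‖
        ≤ ‖T.wpt r₁‖ + ‖((T.mOf r₁ r₂ * T.C + r₀ * T.F : ℤ) : ℂ) * (L.ω₂ / L.ω₁)‖ := norm_add_le _ _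
      _ ≤ 1 + (mB * |(T.C : ℝ)| + (T.N : ℝ) ^ 3 * |(T.F : ℝ)|) * ‖L.ω₂ / L.ω₁‖ := by
          rw [norm_mul]; exact add_le_add hwn (mul_le_mul_of_nonneg_right hMint (norm_nonneg _))
      _ ≤ R := hR
  have hMpt : ∀ r₀ r₁ r₂ : ℤ, |r₀| ≤ (T.N : ℤ) ^ 3 → |r₁| ≤ (T.N : ℤ) ^ 3 → |r₂| ≤ (T.N : ℤ) ^ 3 →
      ‖φ24 L β₁ β₂ T.N p (T.Zpt r₀ r₁ r₂)‖ ≤ M := fun r₀ r₁ r₂ h0 h1 h2 =>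
    hM _ (T.Zpt_mem_xiSet r₀ r₁ r₂ (hwball r₁ h1) (hw'ball r₀ r₁ r₂ h0 h1 h2)) (hZR r₀ r₁ r₂ h0 h1 h2)
  -- the norms of `bᵢ`
  have hb : ∀ i : Fin 2, ‖T.bC i‖ = ‖L.basis i * ℘'[L] (L.basis i / 4)‖ * N4i / ‖L.ω₁ * L.ω₂‖ := by
    intro i; rw [T.norm_bC i, hN4i]; field_simp
  have hb0 : ∀ i : Fin 2, 0 < ‖T.bC i‖ := fun i => norm_pos_iff.mpr (T.bC_ne_zero i)
  -- the three coordinate errors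
  have hKη1 : 1 ≤ Kη T.d K := le_max_left _ _
  have hξ : ∀ r₀ r₁ r₂ : ℤ, |r₀| ≤ (T.N : ℤ) ^ 3 → |r₁| ≤ (T.N : ℤ) ^ 3 → |r₂| ≤ (T.N : ℤ) ^ 3 →
      ‖(T.ξpt β₁ β₂ r₀ r₁ r₂).1 - (r₀ : ℂ) / (T.N : ℂ) ^ 3‖ ≤ Kη T.d K * N4i ∧
      ‖(T.ξpt β₁ β₂ r₀ r₁ r₂).2.1 - (r₁ : ℂ) / (T.N : ℂ) ^ 3‖ ≤ Kη T.d K * N4i ∧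
      ‖(T.ξpt β₁ β₂ r₀ r₁ r₂).2.2 - (r₂ : ℂ) / (T.N : ℂ) ^ 3‖ ≤ Kη T.d K * N4i := by
    intro r₀ r₁ r₂ h0 h1 h2
    have hNc : (T.N : ℂ) ^ 3 ≠ 0 := pow_ne_zero _ (by exact_mod_cast (Nat.pos_iff_ne_zero.mp hN))
    refine ⟨?_, ?_, ?_⟩
    · -- `ξ₀ - r₀/N³ = (f - r₀Δ)/(N³Δ)`
      simp only [ξpt]
      have e : fβ L β₁ β₂ (T.Zpt r₀ r₁ r₂) / ((T.N : ℂ) ^ 3 * T.Δ β₁ β₂) - (r₀ : ℂ) / (T.N : ℂ) ^ 3 =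
          (fβ L β₁ β₂ (T.Zpt r₀ r₁ r₂) - (r₀ : ℂ) * T.Δ β₁ β₂) / ((T.N : ℂ) ^ 3 * T.Δ β₁ β₂) := by
        field_simp
      rw [e, norm_div, norm_mul, norm_pow, Complex.norm_natCast]
      have hf := T.norm_fβ_Zpt_sub_le β₁ β₂ K.hG r₀ r₁ r₂ (hwball r₁ h1) (hw'ball r₀ r₁ r₂ h0 h1 h2)
      have hEf : ‖fβ L β₁ β₂ (T.Zpt r₀ r₁ r₂) - (r₀ : ℂ) * T.Δ β₁ β₂‖ ≤ T.Ef β₁ β₂ K.G mB := by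
        refine hf.trans ?_
        unfold Ef
        have hcoef : 0 ≤ (2 * Real.pi) * (‖β₁‖ * |(T.C : ℝ)| / ‖L.ω₁‖ + ‖β₂‖ * |(T.A : ℝ)| / ‖L.ω₂‖) := by positivity
        have := mul_le_mul_of_nonneg_right (hm r₁ r₂ h1 h2) hcoef
        nlinarith
      have hEf0 : 0 ≤ T.Ef β₁ β₂ K.G mB := by unfold Ef; have := K.hG0; positivity
      -- `Ef/(N³|Δ|) ≤ N⁻⁴ ≤ Kη N⁻⁴`
      have hden : 0 < (T.N : ℝ) ^ 3 * ‖T.Δ β₁ β₂‖ := by positivity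
      rw [div_le_iff₀ hden]
      refine hEf.trans ?_
      have hE1 : T.Ef β₁ β₂ K.G mB ≤ ‖T.Δ β₁ β₂‖ / T.N := by rw [le_div_iff₀ hN0]; exact hΔ2
      calc T.Ef β₁ β₂ K.G mB ≤ ‖T.Δ β₁ β₂‖ / T.N := hE1
        _ = 1 * N4i * ((T.N : ℝ) ^ 3 * ‖T.Δ β₁ β₂‖) := by rw [hN4i]; field_simp
        _ ≤ Kη T.d K * N4i * ((T.N : ℝ) ^ 3 * ‖T.Δ β₁ β₂‖) := by gcongr
    · -- `ξ₁`: Taylor at `z(r₁)` (exact value by (21))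
      simp only [ξpt]
      rw [T.scaledP_zero_Zpt]
      have ht := T.norm_scaledP_wpt_sub_le 0 (K.hCt 0) r₁ ((hw r₁ h1).trans (by linarith))
      have hc := norm_coord_sub_le (T.bC_ne_zero 0) ht
      refine hc.trans ?_
      rw [hb 0, div_le_iff₀ (by positivity)]
      have hu := hw r₁ h1
      have hu2 : ‖T.wpt r₁ - 1 / 4‖ ^ 2 ≤ (N4i / ‖L.ω₁ * L.ω₂‖) ^ 2 := pow_le_pow_left₀ (norm_nonneg _) hu 2
      have hK : K.Ct 0 / (‖L.ω₁ * L.ω₂‖ * ‖L.basis 0 * ℘'[L] (L.basis 0 / 4)‖) ≤ Kη T.d K :=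
        (le_max_left _ _).trans (le_max_right _ _)
      have hCt0 := K.hCt0 0
      calc K.Ct 0 * ‖T.wpt r₁ - 1 / 4‖ ^ 2 ≤ K.Ct 0 * (N4i / ‖L.ω₁ * L.ω₂‖) ^ 2 := mul_le_mul_of_nonneg_left hu2 hCt0
        _ = (K.Ct 0 / (‖L.ω₁ * L.ω₂‖ * ‖L.basis 0 * ℘'[L] (L.basis 0 / 4)‖)) * N4i *
              (‖L.basis 0 * ℘'[L] (L.basis 0 / 4)‖ * N4i / ‖L.ω₁ * L.ω₂‖) := by field_simp
        _ ≤ Kη T.d K * N4i * (‖L.basis 0 * ℘'[L] (L.basis 0 / 4)‖ * N4i / ‖L.ω₁ * L.ω₂‖) := by gcongr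
    · -- `ξ₂`: (23) and Taylor at `z(r₂)`
      simp only [ξpt]
      have h23 := T.norm_scaledP_one_Zpt_sub_le r₀ r₁ r₂ (hw'ball r₀ r₁ r₂ h0 h1 h2) (hwball r₂ h2)
      have ht := T.norm_scaledP_wpt_sub_le 1 (K.hCt 1) r₂ ((hw r₂ h2).trans (by linarith))
      have hr₀ : |(r₀ : ℝ)| ≤ (T.N : ℝ) ^ 3 := by exact_mod_cast h0
      have hsum : ‖scaledP L 1 (T.Zpt r₀ r₁ r₂) - aq L 1 - T.bC 1 * r₂ / (T.N : ℂ) ^ 3‖ ≤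
          (2 * T.d.c₂ + K.Ct 1 / ‖L.ω₁ * L.ω₂‖) * (N4i * N4i) / ‖L.ω₁ * L.ω₂‖ := by
        have e : scaledP L 1 (T.Zpt r₀ r₁ r₂) - aq L 1 - T.bC 1 * r₂ / (T.N : ℂ) ^ 3 =
            (scaledP L 1 (T.Zpt r₀ r₁ r₂) - scaledP L 1 (T.wpt r₂)) +
              (scaledP L 1 (T.wpt r₂) - aq L 1 - T.bC 1 * r₂ / (T.N : ℂ) ^ 3) := by ring
        rw [e]
        refine (norm_add_le _ _).trans ?_
        have e1 : T.d.c₂ * ((‖T.δ‖ / 2 + |(r₀ : ℝ)| * ‖T.ε‖) / ‖L.ω₁ * L.ω₂‖) ≤ T.d.c₂ * (2 * (N4i * N4i)) / ‖L.ω₁ * L.ω₂‖ := by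
          rw [mul_div_assoc]
          refine mul_le_mul_of_nonneg_left (div_le_div_of_nonneg_right ?_ hCω.le) K.hc₂
          have : |(r₀ : ℝ)| * ‖T.ε‖ ≤ (T.N : ℝ) ^ 3 * ‖T.ε‖ := mul_le_mul_of_nonneg_right hr₀ (norm_nonneg _)
          have e8 : 2 * ((T.N : ℝ) ^ 8)⁻¹ = 2 * (N4i * N4i) := by rw [hN4i]; field_simp
          linarith [hδε]
        have e2 : K.Ct 1 * ‖T.wpt r₂ - 1 / 4‖ ^ 2 ≤ K.Ct 1 * (N4i / ‖L.ω₁ * L.ω₂‖) ^ 2 :=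
          mul_le_mul_of_nonneg_left (pow_le_pow_left₀ (norm_nonneg _) (hw r₂ h2) 2) (K.hCt0 1)
        calc _ ≤ T.d.c₂ * (2 * (N4i * N4i)) / ‖L.ω₁ * L.ω₂‖ + K.Ct 1 * (N4i / ‖L.ω₁ * L.ω₂‖) ^ 2 :=
              add_le_add (h23.trans e1) (ht.trans e2)
          _ = (2 * T.d.c₂ + K.Ct 1 / ‖L.ω₁ * L.ω₂‖) * (N4i * N4i) / ‖L.ω₁ * L.ω₂‖ := by field_simp
      have hc := norm_coord_sub_le (T.bC_ne_zero 1) hsum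
      refine hc.trans ?_
      rw [hb 1, div_le_iff₀ (by positivity)]
      have hK : (2 * T.d.c₂ + K.Ct 1 / ‖L.ω₁ * L.ω₂‖) / ‖L.basis 1 * ℘'[L] (L.basis 1 / 4)‖ ≤ Kη T.d K :=
        (le_max_right _ _).trans (le_max_right _ _)
      have hpos : 0 ≤ 2 * T.d.c₂ + K.Ct 1 / ‖L.ω₁ * L.ω₂‖ := by have := K.hc₂; have := K.hCt0 1; positivity
      calc (2 * T.d.c₂ + K.Ct 1 / ‖L.ω₁ * L.ω₂‖) * (N4i * N4i) / ‖L.ω₁ * L.ω₂‖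
          = ((2 * T.d.c₂ + K.Ct 1 / ‖L.ω₁ * L.ω₂‖) / ‖L.basis 1 * ℘'[L] (L.basis 1 / 4)‖) * N4i *
              (‖L.basis 1 * ℘'[L] (L.basis 1 / 4)‖ * N4i / ‖L.ω₁ * L.ω₂‖) := by field_simp
        _ ≤ Kη T.d K * N4i * (‖L.basis 1 * ℘'[L] (L.basis 1 / 4)‖ * N4i / ‖L.ω₁ * L.ω₂‖) := by gcongr
  -- the size bound `X = KX N⁴`
  have hKX1 : 1 ≤ KX L := le_max_left _ _
  have hX1 : 1 ≤ KX L * (T.N : ℝ) ^ 4 := one_le_mul_of_one_le_of_one_le hKX1 (one_le_pow₀ hN1)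
  have hXb : ∀ y : ℝ, |y| ≤ 1 → ‖(y : ℂ) / ((T.N : ℂ) ^ 3 * T.Δ β₁ β₂)‖ ≤ KX L * (T.N : ℝ) ^ 4 ∧
      ‖((y : ℂ) - aq L 0) / T.bC 0‖ ≤ KX L * (T.N : ℝ) ^ 4 ∧ ‖((y : ℂ) - aq L 1) / T.bC 1‖ ≤ KX L * (T.N : ℝ) ^ 4 := by
    intro y hy
    have hy' : ‖(y : ℂ)‖ ≤ 1 := by rw [Complex.norm_real, Real.norm_eq_abs]; exact hy
    refine ⟨?_, ?_, ?_⟩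
    · rw [norm_div, norm_mul, norm_pow, Complex.norm_natCast]
      calc ‖(y : ℂ)‖ / ((T.N : ℝ) ^ 3 * ‖T.Δ β₁ β₂‖) ≤ 1 / 1 := div_le_div₀ zero_le_one hy' one_pos hΔ1
        _ ≤ KX L * (T.N : ℝ) ^ 4 := by rw [div_one]; exact hX1
    · have hK : (1 + ‖aq L 0‖) * ‖L.ω₁ * L.ω₂‖ / ‖L.basis 0 * ℘'[L] (L.basis 0 / 4)‖ ≤ KX L :=
        (le_max_left _ _).trans (le_max_right _ _)
      rw [norm_div, hb 0, div_le_iff₀ (by positivity)]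
      calc ‖(y : ℂ) - aq L 0‖ ≤ ‖(y : ℂ)‖ + ‖aq L 0‖ := norm_sub_le _ _
        _ ≤ 1 + ‖aq L 0‖ := by linarith
        _ = ((1 + ‖aq L 0‖) * ‖L.ω₁ * L.ω₂‖ / ‖L.basis 0 * ℘'[L] (L.basis 0 / 4)‖) * (T.N : ℝ) ^ 4 *
              (‖L.basis 0 * ℘'[L] (L.basis 0 / 4)‖ * N4i / ‖L.ω₁ * L.ω₂‖) := by rw [hN4i]; field_simp
        _ ≤ KX L * (T.N : ℝ) ^ 4 * (‖L.basis 0 * ℘'[L] (L.basis 0 / 4)‖ * N4i / ‖L.ω₁ * L.ω₂‖) := by gcongr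
    · have hK : (1 + ‖aq L 1‖) * ‖L.ω₁ * L.ω₂‖ / ‖L.basis 1 * ℘'[L] (L.basis 1 / 4)‖ ≤ KX L :=
        (le_max_right _ _).trans (le_max_right _ _)
      rw [norm_div, hb 1, div_le_iff₀ (by positivity)]
      calc ‖(y : ℂ) - aq L 1‖ ≤ ‖(y : ℂ)‖ + ‖aq L 1‖ := norm_sub_le _ _
        _ ≤ 1 + ‖aq L 1‖ := by linarith
        _ = ((1 + ‖aq L 1‖) * ‖L.ω₁ * L.ω₂‖ / ‖L.basis 1 * ℘'[L] (L.basis 1 / 4)‖) * (T.N : ℝ) ^ 4 *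
              (‖L.basis 1 * ℘'[L] (L.basis 1 / 4)‖ * N4i / ‖L.ω₁ * L.ω₂‖) := by rw [hN4i]; field_simp
        _ ≤ KX L * (T.N : ℝ) ^ 4 * (‖L.basis 1 * ℘'[L] (L.basis 1 / 4)‖ * N4i / ‖L.ω₁ * L.ω₂‖) := by gcongr
  -- the core
  have hη' : Kη T.d K * N4i + 1 / (2 * (T.N : ℝ) ^ 3) ≤ (21 * (T.N : ℝ) ^ 2)⁻¹ := by rw [hN4i]; exact hη
  exact T.coeff_bound_core β₁ β₂ p hM0 hX1 hΔ0 hMpt hξ hη' hXb hi hj hl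

end PtData

end

/-! ## Part 4: the triples from Lemma 2.2, the asymptotics, and Lemma 2.4 -/

section
/-! ### Elementary inequalities in `t = log N` -/

/-- `11 t ≤ t³³` for `t ≥ 2`. [folklore] -/
theorem eleven_mul_le_pow33 {t : ℝ} (ht : 2 ≤ t) : 11 * t ≤ t ^ 33 := by
  have h1 : (2 : ℝ) ^ 32 ≤ t ^ 32 := pow_le_pow_left₀ (by norm_num) ht 32
  have h2 : t ^ 33 = t * t ^ 32 := by ring
  nlinarith

/-- `t⁸ ≥ 10⁴ t⁴ + 21 t + c` for `t ≥ max 14 (3|c| + 2)`. [folklore] -/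
theorem pow8_ge {t c : ℝ} (ht14 : 14 ≤ t) (htc : 3 * |c| + 2 ≤ t) : 10000 * t ^ 4 + 21 * t + c ≤ t ^ 8 := by
  have ht1 : 1 ≤ t := by linarith
  have h4 : (14 : ℝ) ^ 4 ≤ t ^ 4 := pow_le_pow_left₀ (by norm_num) ht14 4
  have ht4 : 3 * 10000 * t ^ 4 ≤ t ^ 8 := by nlinarith
  have ht7 : t ≤ t ^ 7 := le_self_pow₀ ht1 (by norm_num)
  have h63 : 63 * t ≤ t ^ 8 := by nlinarith
  have hc : 3 * c ≤ t ^ 8 := by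
    have : c ≤ |c| := le_abs_self c
    have : t ≤ t ^ 8 := le_self_pow₀ ht1 (by norm_num)
    linarith
  linarith

/-- `(t³³)^{1/4} = t^{33/4} ≥ t⁸` for `t ≥ 1`. [folklore] -/
theorem rpow_quarter_pow33_ge {t : ℝ} (ht : 1 ≤ t) : t ^ 8 ≤ (t ^ 33) ^ (1 / 4 : ℝ) := by
  have ht0 : 0 ≤ t := by linarith
  rw [show t ^ 33 = t ^ (33 : ℝ) by norm_cast, ← Real.rpow_mul ht0, show (33 : ℝ) * (1 / 4) = 33 / 4 by norm_num,
    show t ^ 8 = t ^ (8 : ℝ) by norm_cast]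
  exact Real.rpow_le_rpow_of_exponent_le ht (by norm_num)

/-- `a + t³⁴ ≤ t³⁶` and `a + 2t³³ + 3t ≤ t³⁴`, `a + 10⁴t⁴ + 20t ≤ t³⁴` for `t` large. [folklore] -/
theorem pow34_bounds {t a : ℝ} (ht : 14 ≤ t) (hta : 3 * |a| + 2 ≤ t) :
    a + t ^ 34 ≤ t ^ 36 ∧ a + 2 * t ^ 33 + 3 * t ≤ t ^ 34 ∧ a + 10000 * t ^ 4 + 20 * t ≤ t ^ 34 := by
  have ht1 : 1 ≤ t := by linarith
  have ha : a ≤ t := by have := le_abs_self a; linarith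
  have h8 := pow8_ge ht hta
  have e1 : t ^ 36 = t ^ 34 * t ^ 2 := by ring
  have e2 : t ^ 34 = t ^ 33 * t := by ring
  have h33 : t ≤ t ^ 33 := le_self_pow₀ ht1 (by norm_num)
  have h34 : t ^ 8 ≤ t ^ 34 := pow_le_pow_right₀ ht1 (by norm_num)
  have ht0 : 0 ≤ t := by linarith
  have ha8 : a ≤ t ^ 8 := by nlinarith
  have hA : t ^ 34 * 2 ≤ t ^ 34 * t ^ 2 := mul_le_mul_of_nonneg_left (by nlinarith) (by positivity)
  have hB : t ^ 33 * 14 ≤ t ^ 33 * t := mul_le_mul_of_nonneg_left ht (by positivity)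
  refine ⟨?_, ?_, ?_⟩
  · rw [e1]; linarith
  · rw [e2]; linarith
  · linarith

/-- The final constant: `2(4N)^{3N}((N+1)³ (2(4N)^{3N} M)(KX N⁴)^{3N}) ≤ (32·4⁶·KX³·N)^{20N} M`
for `N ≥ 2`, `KX ≥ 1`. [folklore] -/
theorem final_const_bound {N : ℕ} (hN : 2 ≤ N) {KX M : ℝ} (hKX : 1 ≤ KX) (hM : 0 ≤ M) :
    2 * (4 * (N : ℝ)) ^ (3 * N) * ((((N : ℝ)) + 1) ^ 3 * (2 * (4 * (N : ℝ)) ^ (3 * N) * M) * (KX * (N : ℝ) ^ 4) ^ (3 * N)) ≤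
      (32 * 4 ^ 6 * KX ^ 3 * N) ^ (20 * N) * M := by
  have hN2 : (2 : ℝ) ≤ N := by exact_mod_cast hN
  have hN1 : (1 : ℝ) ≤ N := by linarith
  set x : ℝ := (N : ℝ) with hx
  -- `(N+1)³ ≤ 8 N^{2N}`
  have h1 : (x + 1) ^ 3 ≤ 8 * x ^ (2 * N) := by
    have e : (x + 1) ^ 3 ≤ (2 * x) ^ 3 := pow_le_pow_left₀ (by linarith) (by linarith) 3
    have e2 : x ^ 3 ≤ x ^ (2 * N) := pow_le_pow_right₀ hN1 (by omega)
    calc (x + 1) ^ 3 ≤ (2 * x) ^ 3 := e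
      _ = 8 * x ^ 3 := by ring
      _ ≤ 8 * x ^ (2 * N) := by linarith
  -- rewrite the left side as `32 (4⁶ KX³)^N N^{18N} (N+1)³ M`-ish and bound
  have hL : 2 * (4 * x) ^ (3 * N) * ((x + 1) ^ 3 * (2 * (4 * x) ^ (3 * N) * M) * (KX * x ^ 4) ^ (3 * N)) =
      4 * (x + 1) ^ 3 * ((4 : ℝ) ^ 6 * KX ^ 3) ^ N * x ^ (18 * N) * M := by
    have e1 : (4 * x) ^ (3 * N) = (4 : ℝ) ^ (3 * N) * x ^ (3 * N) := mul_pow _ _ _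
    have e2 : (KX * x ^ 4) ^ (3 * N) = KX ^ (3 * N) * x ^ (12 * N) := by rw [mul_pow, ← pow_mul]; ring_nf
    have e3 : ((4 : ℝ) ^ 6 * KX ^ 3) ^ N = (4 : ℝ) ^ (6 * N) * KX ^ (3 * N) := by rw [mul_pow, ← pow_mul, ← pow_mul]
    rw [e1, e2, e3]
    have e4 : x ^ (18 * N) = x ^ (3 * N) * x ^ (3 * N) * x ^ (12 * N) := by rw [← pow_add, ← pow_add]; ring_nf
    have e5 : (4 : ℝ) ^ (6 * N) = (4 : ℝ) ^ (3 * N) * (4 : ℝ) ^ (3 * N) := by rw [← pow_add]; ring_nf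
    rw [e4, e5]; ring
  rw [hL]
  have hC1 : (1 : ℝ) ≤ (4 : ℝ) ^ 6 * KX ^ 3 := one_le_mul_of_one_le_of_one_le (by norm_num) (one_le_pow₀ hKX)
  have hR : (32 * 4 ^ 6 * KX ^ 3 * x) ^ (20 * N) * M = (32 : ℝ) ^ (20 * N) * ((4 : ℝ) ^ 6 * KX ^ 3) ^ (20 * N) * x ^ (20 * N) * M := by
    rw [show (32 * 4 ^ 6 * KX ^ 3 * x : ℝ) = 32 * ((4 : ℝ) ^ 6 * KX ^ 3) * x by ring, mul_pow, mul_pow]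
  rw [hR]
  -- compare factor by factor
  have f1 : 4 * (x + 1) ^ 3 ≤ 32 * x ^ (2 * N) := by linarith
  have f2 : (32 : ℝ) * x ^ (2 * N) * x ^ (18 * N) = 32 * x ^ (20 * N) := by rw [mul_assoc, ← pow_add]; ring_nf
  have f3 : (32 : ℝ) ≤ (32 : ℝ) ^ (20 * N) := by
    calc (32 : ℝ) = 32 ^ 1 := (pow_one _).symm
      _ ≤ 32 ^ (20 * N) := pow_le_pow_right₀ (by norm_num) (by omega)
  have f4 : ((4 : ℝ) ^ 6 * KX ^ 3) ^ N ≤ ((4 : ℝ) ^ 6 * KX ^ 3) ^ (20 * N) := pow_le_pow_right₀ hC1 (by omega)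
  have hpos1 : 0 ≤ ((4 : ℝ) ^ 6 * KX ^ 3) ^ N := by positivity
  have hpos2 : 0 ≤ x ^ (18 * N) := by positivity
  have hpos3 : 0 ≤ x ^ (20 * N) := by positivity
  calc 4 * (x + 1) ^ 3 * ((4 : ℝ) ^ 6 * KX ^ 3) ^ N * x ^ (18 * N) * M
      ≤ 32 * x ^ (2 * N) * ((4 : ℝ) ^ 6 * KX ^ 3) ^ N * x ^ (18 * N) * M := by gcongr
    _ = 32 * ((4 : ℝ) ^ 6 * KX ^ 3) ^ N * x ^ (20 * N) * M := by
        rw [show (32 : ℝ) * x ^ (2 * N) * ((4 : ℝ) ^ 6 * KX ^ 3) ^ N * x ^ (18 * N) =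
          ((4 : ℝ) ^ 6 * KX ^ 3) ^ N * (32 * x ^ (2 * N) * x ^ (18 * N)) by ring, f2]; ring
    _ ≤ (32 : ℝ) ^ (20 * N) * ((4 : ℝ) ^ 6 * KX ^ 3) ^ (20 * N) * x ^ (20 * N) * M := by gcongr

/-! ### The "for `L` large" inequalities, as separate real-variable lemmas -/

/-- `2N⁻⁴/‖δ‖ + 1 ≤ 3e^{10⁴t⁴}` when `‖δ‖ > e^{-10⁴t⁴}` (`N⁻⁴ = e^{-4t}`). [folklore] -/
theorem mB_le_aux {t δn : ℝ} (ht : 0 ≤ t) (hδ0 : 0 < δn) (hδlow : Real.exp (-(10000 * t ^ 4)) < δn) :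
    2 * Real.exp (-(4 * t)) / δn + 1 ≤ 3 * Real.exp (10000 * t ^ 4) := by
  have h2 : Real.exp (-(4 * t)) ≤ 1 := by rw [Real.exp_le_one_iff]; linarith
  have h3 : 1 ≤ Real.exp (10000 * t ^ 4) * δn := by
    have := mul_le_mul_of_nonneg_left hδlow.le (Real.exp_nonneg (10000 * t ^ 4))
    rwa [← Real.exp_add, add_neg_cancel, Real.exp_zero] at this
  have h1 : 2 * Real.exp (-(4 * t)) / δn ≤ 2 * Real.exp (10000 * t ^ 4) := by
    rw [div_le_iff₀ hδ0]; nlinarith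
  have h4 : 1 ≤ Real.exp (10000 * t ^ 4) := Real.one_le_exp (by positivity)
  linarith

/-- The lower bound (28) for `Δ` in the form used: `K₃e^{10⁴t⁴+21t} + 1 ≤ ‖Δ‖`. [cite: Masser1975, §2.3 (28)] -/
theorem Δ_lower_aux {t c₃ cΔ cΔ' K₃ Fa Δn : ℝ} (hc₃ : 0 < c₃) (hcΔ : 0 < cΔ) (hK₃ : 0 < K₃) (ht14 : 14 ≤ t)
    (hFlow : c₃ * Real.exp (t ^ 8) ≤ Fa) (hΔge : cΔ * Fa - cΔ' ≤ Δn)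
    (hta₁ : 3 * |Real.log (2 * (|cΔ'| + 1) / (cΔ * c₃))| + 2 ≤ t)
    (hta₂ : 3 * |Real.log (2 * K₃ / (cΔ * c₃))| + 2 ≤ t) :
    K₃ * Real.exp (10000 * t ^ 4 + 21 * t) + 1 ≤ Δn := by
  have h8a := pow8_ge ht14 hta₁
  have h8b := pow8_ge ht14 hta₂
  have hcc : 0 < cΔ * c₃ := mul_pos hcΔ hc₃
  have ht0 : 0 ≤ t := by linarith
  have hpos : 0 ≤ 10000 * t ^ 4 + 21 * t := by positivity
  have hexpA : 2 * (|cΔ'| + 1) ≤ cΔ * c₃ * Real.exp (t ^ 8) := by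
    have h1 : Real.log (2 * (|cΔ'| + 1) / (cΔ * c₃)) ≤ t ^ 8 := by linarith
    have h2 : 2 * (|cΔ'| + 1) / (cΔ * c₃) ≤ Real.exp (t ^ 8) := by
      rw [← Real.exp_log (by positivity : 0 < 2 * (|cΔ'| + 1) / (cΔ * c₃))]; exact Real.exp_le_exp.mpr h1
    have h3 := (div_le_iff₀ hcc).mp h2
    linarith
  have hexpB : 2 * K₃ * Real.exp (10000 * t ^ 4 + 21 * t) ≤ cΔ * c₃ * Real.exp (t ^ 8) := by
    have h1 : Real.log (2 * K₃ / (cΔ * c₃)) + (10000 * t ^ 4 + 21 * t) ≤ t ^ 8 := by linarith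
    have h2 : 2 * K₃ / (cΔ * c₃) * Real.exp (10000 * t ^ 4 + 21 * t) ≤ Real.exp (t ^ 8) := by
      rw [← Real.exp_log (by positivity : 0 < 2 * K₃ / (cΔ * c₃)), ← Real.exp_add]; exact Real.exp_le_exp.mpr h1
    rw [div_mul_eq_mul_div, div_le_iff₀ hcc] at h2
    linarith
  have h1 : cΔ * (c₃ * Real.exp (t ^ 8)) ≤ cΔ * Fa := mul_le_mul_of_nonneg_left hFlow hcΔ.le
  have h2 : cΔ' ≤ |cΔ'| := le_abs_self _
  linarith

/-- The grid inequality `Kη N⁻⁴ + 1/(2N³) ≤ 1/(21N²)` for `N ≥ max(42Kη, 21)`. [folklore] -/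
theorem eta_aux {Nr K : ℝ} (hK1 : 1 ≤ K) (hNK : 42 * K ≤ Nr) (hN21 : 21 ≤ Nr) :
    K * (Nr ^ 4)⁻¹ + 1 / (2 * Nr ^ 3) ≤ (21 * Nr ^ 2)⁻¹ := by
  have hN0 : 0 < Nr := by linarith
  have key : (K * (Nr ^ 4)⁻¹ + 1 / (2 * Nr ^ 3)) * (21 * Nr ^ 2) ≤ 1 := by
    have e : (K * (Nr ^ 4)⁻¹ + 1 / (2 * Nr ^ 3)) * (21 * Nr ^ 2) = 21 * K / Nr ^ 2 + 21 / (2 * Nr) := by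
      field_simp
    rw [e]
    have h3 : 42 * K * 1 ≤ 42 * K * Nr := mul_le_mul_of_nonneg_left (by linarith) (by linarith)
    have h4 : 42 * K * Nr ≤ Nr * Nr := mul_le_mul_of_nonneg_right hNK hN0.le
    have h1 : 21 * K / Nr ^ 2 ≤ 1 / 2 := by
      rw [div_le_iff₀ (by positivity)]; nlinarith
    have h2 : 21 / (2 * Nr) ≤ 1 / 2 := by
      rw [div_le_iff₀ (by positivity)]; linarith
    linarith
  calc K * (Nr ^ 4)⁻¹ + 1 / (2 * Nr ^ 3) ≤ 1 / (21 * Nr ^ 2) := (le_div_iff₀ (by positivity)).mpr key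
    _ = (21 * Nr ^ 2)⁻¹ := one_div _

/-- The radius: `1 + (mB|C| + N³|F|)|τ| ≤ e^{t³⁶}`. [folklore] -/
theorem radius_aux {t c₂ mB Ca Fa τn N3 : ℝ} (ht14 : 14 ≤ t) (hc₂ : 0 < c₂) (hτ0 : 0 ≤ τn)
    (hmBle : mB ≤ 3 * Real.exp (10000 * t ^ 4)) (hCa0 : 0 ≤ Ca) (hC : Ca ≤ c₂ * Real.exp (20 * t))
    (hFup : Fa ≤ c₂ * Real.exp (2 * t ^ 33)) (hN3e : N3 = Real.exp (3 * t))
    (hta₃ : 3 * |Real.log (3 * c₂ * τn + 1)| + 2 ≤ t) (hta₄ : 3 * |Real.log (c₂ * τn + 1)| + 2 ≤ t) :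
    1 + (mB * Ca + N3 * Fa) * τn ≤ Real.exp (t ^ 36) := by
  subst hN3e
  obtain ⟨-, -, hr3⟩ := pow34_bounds ht14 hta₃
  obtain ⟨-, hr2, -⟩ := pow34_bounds ht14 hta₄
  have hlog3 : 3 * |Real.log 3| + 2 ≤ t := by
    have h1 : Real.log 3 < 2 := by
      have : Real.log 3 < Real.log (Real.exp 2) :=
        Real.log_lt_log (by norm_num) (by linarith [(PData.exp_consts).2.1])
      rwa [Real.log_exp] at this
    have h0 : 0 ≤ Real.log 3 := Real.log_nonneg (by norm_num)
    rw [abs_of_nonneg h0]; linarith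
  obtain ⟨hr0, -, -⟩ := pow34_bounds ht14 hlog3
  have e1 : mB * Ca * τn ≤ Real.exp (t ^ 34) := by
    have h1 : mB * Ca * τn ≤ 3 * Real.exp (10000 * t ^ 4) * (c₂ * Real.exp (20 * t)) * τn :=
      mul_le_mul_of_nonneg_right (mul_le_mul hmBle hC hCa0 (by positivity)) hτ0
    have h3 : 3 * c₂ * τn ≤ Real.exp (Real.log (3 * c₂ * τn + 1)) := by
      rw [Real.exp_log (by positivity)]; linarith
    have h4 : 3 * Real.exp (10000 * t ^ 4) * (c₂ * Real.exp (20 * t)) * τn ≤ Real.exp (t ^ 34) :=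
      calc 3 * Real.exp (10000 * t ^ 4) * (c₂ * Real.exp (20 * t)) * τn
          = (3 * c₂ * τn) * (Real.exp (10000 * t ^ 4) * Real.exp (20 * t)) := by ring
        _ ≤ Real.exp (Real.log (3 * c₂ * τn + 1)) * (Real.exp (10000 * t ^ 4) * Real.exp (20 * t)) :=
            mul_le_mul_of_nonneg_right h3 (by positivity)
        _ = Real.exp (Real.log (3 * c₂ * τn + 1) + 10000 * t ^ 4 + 20 * t) := by
            rw [← Real.exp_add, ← Real.exp_add]; ring_nf
        _ ≤ Real.exp (t ^ 34) := Real.exp_le_exp.mpr hr3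
    exact h1.trans h4
  have e2 : Real.exp (3 * t) * Fa * τn ≤ Real.exp (t ^ 34) := by
    have h1 : Real.exp (3 * t) * Fa * τn ≤ Real.exp (3 * t) * (c₂ * Real.exp (2 * t ^ 33)) * τn :=
      mul_le_mul_of_nonneg_right (mul_le_mul_of_nonneg_left hFup (Real.exp_nonneg _)) hτ0
    have h3 : c₂ * τn ≤ Real.exp (Real.log (c₂ * τn + 1)) := by rw [Real.exp_log (by positivity)]; linarith
    have h4 : Real.exp (3 * t) * (c₂ * Real.exp (2 * t ^ 33)) * τn ≤ Real.exp (t ^ 34) :=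
      calc Real.exp (3 * t) * (c₂ * Real.exp (2 * t ^ 33)) * τn
          = (c₂ * τn) * (Real.exp (3 * t) * Real.exp (2 * t ^ 33)) := by ring
        _ ≤ Real.exp (Real.log (c₂ * τn + 1)) * (Real.exp (3 * t) * Real.exp (2 * t ^ 33)) :=
            mul_le_mul_of_nonneg_right h3 (by positivity)
        _ = Real.exp (Real.log (c₂ * τn + 1) + 2 * t ^ 33 + 3 * t) := by
            rw [← Real.exp_add, ← Real.exp_add]; ring_nf
        _ ≤ Real.exp (t ^ 34) := Real.exp_le_exp.mpr hr2
    exact h1.trans h4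
  have e3 : 1 + 2 * Real.exp (t ^ 34) ≤ Real.exp (t ^ 36) := by
    have h1 : 1 ≤ Real.exp (t ^ 34) := Real.one_le_exp (by positivity)
    have h2 : 3 * Real.exp (t ^ 34) ≤ Real.exp (t ^ 36) :=
      calc 3 * Real.exp (t ^ 34) = Real.exp (Real.log 3 + t ^ 34) := by
            rw [Real.exp_add, Real.exp_log (by norm_num)]
        _ ≤ Real.exp (t ^ 36) := Real.exp_le_exp.mpr hr0
    linarith
  have e4 : (mB * Ca + Real.exp (3 * t) * Fa) * τn = mB * Ca * τn + Real.exp (3 * t) * Fa * τn := by ring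
  rw [e4]; linarith

namespace PtData

variable {L : PeriodPair} (T : PtData L)

/-- The size of `Ef` (the error in (26)) for the data of Lemma 2.2. [cite: Masser1975, §2.3 (26)] -/
theorem Ef_le_aux {β₁ β₂ : ℂ} (K : AsmConsts L T.d β₁ β₂) {t c₂ mB : ℝ} (ht : 0 ≤ t)
    (hmBle : mB ≤ 3 * Real.exp (10000 * t ^ 4))
    (hA : |(T.A : ℝ)| ≤ c₂ * Real.exp (20 * t)) (hC : |(T.C : ℝ)| ≤ c₂ * Real.exp (20 * t)) :
    T.Ef β₁ β₂ K.G mB ≤ ((‖β₁‖ + ‖β₂‖) * K.G + 3 * (2 * Real.pi) * c₂ * (‖β₁‖ / ‖L.ω₁‖ + ‖β₂‖ / ‖L.ω₂‖) + 1) *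
      Real.exp (10000 * t ^ 4) * Real.exp (20 * t) := by
  unfold Ef
  have hE1 : 1 ≤ Real.exp (10000 * t ^ 4) := Real.one_le_exp (by positivity)
  have hE2 : 1 ≤ Real.exp (20 * t) := Real.one_le_exp (by positivity)
  have hω₁ : 0 < ‖L.ω₁‖ := norm_pos_iff.mpr ω₁_ne
  have hω₂ : 0 < ‖L.ω₂‖ := norm_pos_iff.mpr ω₂_ne
  have hG0 := K.hG0
  set E := Real.exp (10000 * t ^ 4) * Real.exp (20 * t) with hE
  have hE1' : 1 ≤ E := one_le_mul_of_one_le_of_one_le hE1 hE2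
  set Bw : ℝ := ‖β₁‖ / ‖L.ω₁‖ + ‖β₂‖ / ‖L.ω₂‖ with hBw
  have hBw0 : 0 ≤ Bw := by positivity
  have hco : ‖β₁‖ * |(T.C : ℝ)| / ‖L.ω₁‖ + ‖β₂‖ * |(T.A : ℝ)| / ‖L.ω₂‖ ≤ c₂ * Real.exp (20 * t) * Bw := by
    have e1 : ‖β₁‖ * |(T.C : ℝ)| / ‖L.ω₁‖ ≤ ‖β₁‖ * (c₂ * Real.exp (20 * t)) / ‖L.ω₁‖ :=
      div_le_div_of_nonneg_right (mul_le_mul_of_nonneg_left hC (norm_nonneg _)) hω₁.le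
    have e2 : ‖β₂‖ * |(T.A : ℝ)| / ‖L.ω₂‖ ≤ ‖β₂‖ * (c₂ * Real.exp (20 * t)) / ‖L.ω₂‖ :=
      div_le_div_of_nonneg_right (mul_le_mul_of_nonneg_left hA (norm_nonneg _)) hω₂.le
    calc _ ≤ ‖β₁‖ * (c₂ * Real.exp (20 * t)) / ‖L.ω₁‖ + ‖β₂‖ * (c₂ * Real.exp (20 * t)) / ‖L.ω₂‖ := add_le_add e1 e2
      _ = c₂ * Real.exp (20 * t) * Bw := by rw [hBw]; ring
  have hc₂e : 0 ≤ c₂ * Real.exp (20 * t) := (abs_nonneg _).trans hA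
  have hmain : mB * (2 * Real.pi) * (‖β₁‖ * |(T.C : ℝ)| / ‖L.ω₁‖ + ‖β₂‖ * |(T.A : ℝ)| / ‖L.ω₂‖) ≤
      (3 * Real.exp (10000 * t ^ 4)) * (2 * Real.pi) * (c₂ * Real.exp (20 * t) * Bw) :=
    mul_le_mul (mul_le_mul_of_nonneg_right hmBle (by positivity)) hco (by positivity) (by positivity)
  have hmain' : (3 * Real.exp (10000 * t ^ 4)) * (2 * Real.pi) * (c₂ * Real.exp (20 * t) * Bw) =
      3 * (2 * Real.pi) * c₂ * Bw * E := by rw [hE]; ring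
  have hfirst : (‖β₁‖ + ‖β₂‖) * K.G ≤ (‖β₁‖ + ‖β₂‖) * K.G * E :=
    le_mul_of_one_le_right (by positivity) hE1'
  have hE0 : 0 ≤ E := by positivity
  have hexp : ((‖β₁‖ + ‖β₂‖) * K.G + 3 * (2 * Real.pi) * c₂ * Bw + 1) * Real.exp (10000 * t ^ 4) * Real.exp (20 * t) =
      (‖β₁‖ + ‖β₂‖) * K.G * E + 3 * (2 * Real.pi) * c₂ * Bw * E + E := by rw [hE]; ring
  rw [hexp]
  linarith

/-- **The numerical hypotheses hold for the data produced by Lemma 2.2** (all the "for `L > c`"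
steps of the proof of Lemma 2.4). [cite: Masser1975, §2.3 (proof of Lemma 2.4)] -/
theorem coeff_bound_of_data {β₁ β₂ : ℂ} (K : AsmConsts L T.d β₁ β₂) {t c₂ c₃ cΔ cΔ' : ℝ}
    (hc₂ : 0 < c₂) (hc₃ : 0 < c₃) (hcΔ : 0 < cΔ)
    (ht14 : 14 ≤ t) (hNexp : (T.N : ℝ) = Real.exp t) (hN2 : 2 ≤ T.N)
    (hNρ : 10 / (‖L.ω₁ * L.ω₂‖ * T.d.ρ) ≤ T.N) (hNK : 42 * Kη T.d K ≤ T.N) (hN21 : (21 : ℝ) ≤ T.N)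
    (hδup : ‖T.δ‖ < Real.exp (-(10 * t))) (hδlow : Real.exp (-(10000 * t ^ 4)) < ‖T.δ‖)
    (hεup : ‖T.ε‖ < Real.exp (-t ^ 33))
    (hA : |(T.A : ℝ)| ≤ c₂ * Real.exp (20 * t)) (hC : |(T.C : ℝ)| ≤ c₂ * Real.exp (20 * t))
    (hFup : |(T.F : ℝ)| ≤ c₂ * Real.exp (2 * t ^ 33)) (hFlow : c₃ * Real.exp (t ^ 8) ≤ |(T.F : ℝ)|)
    (hΔge : cΔ * |(T.F : ℝ)| - cΔ' ≤ ‖T.Δ β₁ β₂‖)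
    (hta₁ : 3 * |Real.log (2 * (|cΔ'| + 1) / (cΔ * c₃))| + 2 ≤ t)
    (hta₂ : 3 * |Real.log (2 * ((‖β₁‖ + ‖β₂‖) * K.G + 3 * (2 * Real.pi) * c₂ * (‖β₁‖ / ‖L.ω₁‖ + ‖β₂‖ / ‖L.ω₂‖) + 1) /
      (cΔ * c₃))| + 2 ≤ t)
    (hta₃ : 3 * |Real.log (3 * c₂ * ‖L.ω₂ / L.ω₁‖ + 1)| + 2 ≤ t)
    (hta₄ : 3 * |Real.log (c₂ * ‖L.ω₂ / L.ω₁‖ + 1)| + 2 ≤ t)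
    (p : ℕ → ℕ → ℕ → ℂ) {M : ℝ} (hM0 : 0 ≤ M)
    (hM : ∀ z ∈ xiSet T.d, ‖z‖ ≤ Real.exp (t ^ 36) → ‖φ24 L β₁ β₂ T.N p z‖ ≤ M)
    {i j l : ℕ} (hi : i ≤ T.N) (hj : j ≤ T.N) (hl : l ≤ T.N) :
    ‖p i j l‖ ≤ 2 * (4 * T.N) ^ (3 * T.N) *
      (((T.N : ℝ) + 1) ^ 3 * (2 * (4 * T.N) ^ (3 * T.N) * M) * (KX L * (T.N : ℝ) ^ 4) ^ (3 * T.N)) := by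
  have hN1 : (1 : ℝ) ≤ T.N := by
    have : (2 : ℝ) ≤ T.N := by exact_mod_cast hN2
    linarith
  have hNpos : (0 : ℝ) < T.N := by linarith
  have hCω := Cω_pos (L := L)
  have hρ := T.d.ρ_pos
  have ht0 : 0 ≤ t := by linarith
  have hδ0 : 0 < ‖T.δ‖ := norm_pos_iff.mpr T.hδ
  -- powers of `N`
  have hNk : ∀ k : ℕ, (T.N : ℝ) ^ k = Real.exp (k * t) := fun k => by rw [hNexp, ← Real.exp_nat_mul]
  have hN4i : ((T.N : ℝ) ^ 4)⁻¹ = Real.exp (-(4 * t)) := by rw [hNk 4, Real.exp_neg]; norm_num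
  have hN8i : ((T.N : ℝ) ^ 8)⁻¹ = Real.exp (-(8 * t)) := by rw [hNk 8, Real.exp_neg]; norm_num
  have hN3e : (T.N : ℝ) ^ 3 = Real.exp (3 * t) := by rw [hNk 3]; norm_num
  -- `hρ`
  have hρ' : 10 / (‖L.ω₁ * L.ω₂‖ * (T.N : ℝ) ^ 4) ≤ T.d.ρ := by
    have hN4 : (T.N : ℝ) ≤ (T.N : ℝ) ^ 4 := le_self_pow₀ hN1 (by norm_num)
    rw [div_le_iff₀ (by positivity)]
    rw [div_le_iff₀ (by positivity)] at hNρ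
    calc (10 : ℝ) ≤ T.N * (‖L.ω₁ * L.ω₂‖ * T.d.ρ) := hNρ
      _ ≤ (T.N : ℝ) ^ 4 * (‖L.ω₁ * L.ω₂‖ * T.d.ρ) := mul_le_mul_of_nonneg_right hN4 (by positivity)
      _ = T.d.ρ * (‖L.ω₁ * L.ω₂‖ * (T.N : ℝ) ^ 4) := by ring
  -- `mB`
  set mB : ℝ := 2 * ((T.N : ℝ) ^ 4)⁻¹ / ‖T.δ‖ + 1 with hmB
  have hmBle : mB ≤ 3 * Real.exp (10000 * t ^ 4) := by
    rw [hmB, hN4i]; exact mB_le_aux ht0 hδ0 hδlow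
  -- `hshift`, `hδε`
  have hε3 : (T.N : ℝ) ^ 3 * ‖T.ε‖ ≤ Real.exp (-(8 * t)) := by
    rw [hN3e]
    have h1 : Real.exp (3 * t) * ‖T.ε‖ ≤ Real.exp (3 * t) * Real.exp (-t ^ 33) :=
      mul_le_mul_of_nonneg_left hεup.le (Real.exp_nonneg _)
    rw [← Real.exp_add] at h1
    have h11 := eleven_mul_le_pow33 (by linarith : (2 : ℝ) ≤ t)
    exact h1.trans (Real.exp_le_exp.mpr (by linarith))
  have he84 : Real.exp (-(8 * t)) ≤ Real.exp (-(4 * t)) := Real.exp_le_exp.mpr (by linarith)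
  have he104 : Real.exp (-(10 * t)) ≤ Real.exp (-(4 * t)) := Real.exp_le_exp.mpr (by linarith)
  have he108 : Real.exp (-(10 * t)) ≤ Real.exp (-(8 * t)) := Real.exp_le_exp.mpr (by linarith)
  have hshift : mB * ‖T.δ‖ + (T.N : ℝ) ^ 3 * ‖T.ε‖ ≤ 4 * ((T.N : ℝ) ^ 4)⁻¹ := by
    have e : mB * ‖T.δ‖ = 2 * ((T.N : ℝ) ^ 4)⁻¹ + ‖T.δ‖ := by rw [hmB]; field_simp
    rw [e, hN4i]
    linarith [hδup.le]
  have hδε : ‖T.δ‖ / 2 + (T.N : ℝ) ^ 3 * ‖T.ε‖ ≤ 2 * ((T.N : ℝ) ^ 8)⁻¹ := by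
    rw [hN8i]; linarith [hδup.le]
  -- `Δ`
  set K₃ : ℝ := (‖β₁‖ + ‖β₂‖) * K.G + 3 * (2 * Real.pi) * c₂ * (‖β₁‖ / ‖L.ω₁‖ + ‖β₂‖ / ‖L.ω₂‖) + 1 with hK₃
  have hK₃0 : 0 < K₃ := by rw [hK₃]; have := K.hG0; positivity
  have hEf : T.Ef β₁ β₂ K.G mB ≤ K₃ * Real.exp (10000 * t ^ 4) * Real.exp (20 * t) :=
    T.Ef_le_aux K ht0 hmBle hA hC
  have hΔlow : K₃ * Real.exp (10000 * t ^ 4 + 21 * t) + 1 ≤ ‖T.Δ β₁ β₂‖ :=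
    Δ_lower_aux hc₃ hcΔ hK₃0 ht14 hFlow hΔge hta₁ hta₂
  have hX0 : 0 ≤ Real.exp (10000 * t ^ 4 + 21 * t) := Real.exp_nonneg _
  have hΔ1 : 1 ≤ (T.N : ℝ) ^ 3 * ‖T.Δ β₁ β₂‖ := by
    have h0 := mul_nonneg hK₃0.le hX0
    have h1 : 1 ≤ ‖T.Δ β₁ β₂‖ := by linarith
    have h2 : (1 : ℝ) ≤ (T.N : ℝ) ^ 3 := one_le_pow₀ hN1
    exact one_le_mul_of_one_le_of_one_le h2 h1
  have hΔ2 : T.Ef β₁ β₂ K.G mB * T.N ≤ ‖T.Δ β₁ β₂‖ := by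
    have h1 : T.Ef β₁ β₂ K.G mB * T.N ≤ K₃ * Real.exp (10000 * t ^ 4) * Real.exp (20 * t) * Real.exp t := by
      rw [hNexp] at hNpos ⊢; exact mul_le_mul_of_nonneg_right hEf hNpos.le
    have h2 : K₃ * Real.exp (10000 * t ^ 4) * Real.exp (20 * t) * Real.exp t =
        K₃ * Real.exp (10000 * t ^ 4 + 21 * t) := by
      rw [mul_assoc, mul_assoc, ← Real.exp_add, ← Real.exp_add]; ring_nf
    linarith
  -- `hη`
  have hη : Kη T.d K * ((T.N : ℝ) ^ 4)⁻¹ + 1 / (2 * (T.N : ℝ) ^ 3) ≤ (21 * (T.N : ℝ) ^ 2)⁻¹ :=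
    eta_aux (le_max_left _ _) hNK hN21
  -- `hR`
  have hR : 1 + (mB * |(T.C : ℝ)| + (T.N : ℝ) ^ 3 * |(T.F : ℝ)|) * ‖L.ω₂ / L.ω₁‖ ≤ Real.exp (t ^ 36) :=
    radius_aux ht14 hc₂ (norm_nonneg _) hmBle (abs_nonneg _) hC hFup hN3e hta₃ hta₄
  -- conclude
  exact T.coeff_bound_of_hyps K p hM0 hN2 hρ' (le_of_eq hmB.symm) hshift hδε hΔ1 hΔ2 hη hR hM hi hj hl

end PtData


/-! ### Lemma 2.4 -/

/-- **Lemma 2.4 (the Main Lemma)** of Masser 1975. [cite: Masser1975, Lemma 2.4] -/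
theorem masser_lemma_2_4 (S : TSetup) (hCM : ¬ S.L.HasCM) (d : DiscData S.L) {β₁ β₂ : ℂ}
    (hβ₂ : β₂ ≠ 0) (hconj : (starRingEnd ℂ) β₁ * S.L.ω₁ + (starRingEnd ℂ) β₂ * S.L.ω₂ ≠ 0) :
    ∃ Cc : ℝ, 0 < Cc ∧ ∃ N₀ : ℕ, ∀ N : ℕ, N₀ ≤ N → ∀ (p : ℕ → ℕ → ℕ → ℂ) (M : ℝ), 0 ≤ M →
      (∀ z ∈ xiSet d, ‖z‖ ≤ Real.exp (Real.log N ^ 36) → ‖φ24 S.L β₁ β₂ N p z‖ ≤ M) →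
      ∀ i j l : ℕ, i ≤ N → j ≤ N → l ≤ N → ‖p i j l‖ ≤ (Cc * N) ^ (20 * N) * M := by
  -- constants
  obtain ⟨c₂, c₃, X₀, hc₂, hc₃, h22⟩ := masser_lemma_2_2 S hCM
  obtain ⟨K⟩ := PtData.exists_asmConsts S.L d β₁ β₂
  obtain ⟨cΔ, cΔ', hcΔ, hΔge⟩ := norm_Δ_ge S.L β₁ β₂ hβ₂ hconj
  have hCω : 0 < ‖S.L.ω₁ * S.L.ω₂‖ := norm_pos_iff.mpr (mul_ne_zero (by simpa using basis_ne_zero S.L 0) (by simpa using basis_ne_zero S.L 1))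
  have hρ := d.ρ_pos
  set βn : ℝ := ‖β₁‖ + ‖β₂‖ with hβn
  set τn : ℝ := ‖S.L.ω₂ / S.L.ω₁‖ with hτn
  set K₃ : ℝ := βn * K.G + 3 * (2 * Real.pi) * c₂ * (‖β₁‖ / ‖S.L.ω₁‖ + ‖β₂‖ / ‖S.L.ω₂‖) + 1 with hK₃
  have hK₃0 : 0 < K₃ := by rw [hK₃]; have := K.hG0; positivity
  -- the thresholds in `t = log N`
  set a₁ : ℝ := Real.log (2 * (|cΔ'| + 1) / (cΔ * c₃)) with ha₁
  set a₂ : ℝ := Real.log (2 * K₃ / (cΔ * c₃)) with ha₂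
  set a₃ : ℝ := Real.log (3 * c₂ * τn + 1) with ha₃
  set a₄ : ℝ := Real.log (c₂ * τn + 1) with ha₄
  set T₀ : ℝ := max 14 (max (3 * |a₁| + 2) (max (3 * |a₂| + 2) (max (3 * |a₃| + 2) (max (3 * |a₄| + 2)
    (max (Real.log (max X₀ 1) + 1) 2))))) with hT₀
  set N₀ : ℕ := ⌈Real.exp T₀⌉₊ + 42 * ⌈PtData.Kη d K⌉₊ + ⌈10 / (‖S.L.ω₁ * S.L.ω₂‖ * d.ρ)⌉₊ + 21 + 3 with hN₀
  -- the constant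
  set Cc : ℝ := 32 * 4 ^ 6 * PtData.KX S.L ^ 3 with hCc
  have hKX1 : 1 ≤ PtData.KX S.L := le_max_left _ _
  have hCc1 : 1 ≤ Cc := by
    rw [hCc]; have : (1 : ℝ) ≤ PtData.KX S.L ^ 3 := one_le_pow₀ hKX1; nlinarith
  refine ⟨Cc, by linarith, N₀, fun N hN p M hM0 hφ i j l hi hj hl => ?_⟩
  -- unpack `N ≥ N₀`
  have hNN₀ : (N₀ : ℝ) ≤ N := by exact_mod_cast hN
  have hN₀ge : Real.exp T₀ + 42 * PtData.Kη d K + 10 / (‖S.L.ω₁ * S.L.ω₂‖ * d.ρ) + 21 + 3 ≤ (N₀ : ℝ) := by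
    rw [hN₀]; push_cast
    have h1 := Nat.le_ceil (Real.exp T₀)
    have h2 := Nat.le_ceil (PtData.Kη d K)
    have h3 := Nat.le_ceil (10 / (‖S.L.ω₁ * S.L.ω₂‖ * d.ρ))
    linarith
  have hKη1 : 1 ≤ PtData.Kη d K := le_max_left _ _
  have hN3 : (3 : ℝ) ≤ N := by
    have : 0 ≤ 10 / (‖S.L.ω₁ * S.L.ω₂‖ * d.ρ) := by positivity
    linarith [Real.exp_pos T₀]
  have hN2 : 2 ≤ N := by exact_mod_cast (show (2 : ℝ) ≤ N by linarith)
  have hN1 : 1 ≤ N := by omega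
  have hNpos : (0 : ℝ) < N := by linarith
  set t := Real.log N with ht
  have hNexp : (N : ℝ) = Real.exp t := by rw [ht, Real.exp_log hNpos]
  have htT₀ : T₀ ≤ t := by
    rw [ht, ← Real.log_exp T₀]
    refine Real.log_le_log (Real.exp_pos _) ?_
    have : 0 ≤ 10 / (‖S.L.ω₁ * S.L.ω₂‖ * d.ρ) := by positivity
    linarith
  have ht14 : 14 ≤ t := (le_max_left _ _).trans htT₀
  have hta₁ : 3 * |a₁| + 2 ≤ t := ((le_max_left _ _).trans (le_max_right _ _)).trans htT₀
  have hta₂ : 3 * |a₂| + 2 ≤ t := ((le_max_left _ _).trans ((le_max_right _ _).trans (le_max_right _ _))).trans htT₀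
  have hta₃ : 3 * |a₃| + 2 ≤ t :=
    ((le_max_left _ _).trans ((le_max_right _ _).trans ((le_max_right _ _).trans (le_max_right _ _)))).trans htT₀
  have hta₄ : 3 * |a₄| + 2 ≤ t :=
    ((le_max_left _ _).trans ((le_max_right _ _).trans ((le_max_right _ _).trans ((le_max_right _ _).trans
      (le_max_right _ _))))).trans htT₀
  have htX₀ : Real.log (max X₀ 1) + 1 ≤ t :=
    ((le_max_left _ _).trans ((le_max_right _ _).trans ((le_max_right _ _).trans ((le_max_right _ _).trans
      ((le_max_right _ _).trans (le_max_right _ _)))))).trans htT₀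
  have ht2 : 2 ≤ t := by linarith
  have ht1 : 1 ≤ t := by linarith
  have ht0 : 0 ≤ t := by linarith
  -- the two `X`
  have hX₀1 : X₀ ≤ Real.exp t := by
    have h1 : X₀ ≤ max X₀ 1 := le_max_left _ _
    have h2 : max X₀ 1 = Real.exp (Real.log (max X₀ 1)) := (Real.exp_log (lt_of_lt_of_le one_pos (le_max_right _ _))).symm
    rw [h2] at h1
    exact h1.trans (Real.exp_le_exp.mpr (by linarith))
  set X₁ : ℝ := (N : ℝ) ^ 10 with hX₁
  set X₂ : ℝ := Real.exp (t ^ 33) with hX₂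
  have hX₁exp : X₁ = Real.exp (10 * t) := by rw [hX₁, hNexp, ← Real.exp_nat_mul]; norm_num
  have hX₁ge : X₀ ≤ X₁ := hX₀1.trans (by rw [hX₁exp]; exact Real.exp_le_exp.mpr (by linarith))
  have hX₂ge : X₀ ≤ X₂ := hX₀1.trans (by rw [hX₂]; exact Real.exp_le_exp.mpr (le_self_pow₀ ht1 (by norm_num)))
  obtain ⟨v₁, hv₁0, hδlow, hδup, -, hH₁, -⟩ := h22 X₁ hX₁ge
  obtain ⟨v₂, hv₂0, hεlow, hεup, hH₂low, hH₂, hF⟩ := h22 X₂ hX₂ge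
  -- logs and squares of the `X`
  have hlogX₁ : Real.log X₁ = 10 * t := by rw [hX₁exp, Real.log_exp]
  have hlogX₂ : Real.log X₂ = t ^ 33 := by rw [hX₂, Real.log_exp]
  have hX₁sq : X₁ ^ 2 = Real.exp (20 * t) := by
    rw [hX₁exp, ← Real.exp_nat_mul]; congr 1; push_cast; ring
  have hX₂sq : X₂ ^ 2 = Real.exp (2 * t ^ 33) := by
    rw [hX₂, ← Real.exp_nat_mul]; norm_num
  rw [hlogX₁] at hδlow
  rw [hlogX₂] at hH₂low
  -- the data `T`
  have hδne : periodForm S.L v₁ ≠ 0 := norm_pos_iff.mp (lt_trans (Real.exp_pos _) hδlow)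
  have hδne' : periodForm S.L (v₁.1, v₁.2.1, v₁.2.2) ≠ 0 := hδne
  -- `‖δ‖ < exp(-10t)`, `exp(-10⁴t⁴) < ‖δ‖`, `‖ε‖ < exp(-t³³)`
  have hδup' : ‖periodForm S.L (v₁.1, v₁.2.1, v₁.2.2)‖ < Real.exp (-(10 * t)) := by
    rw [Real.exp_neg, ← hX₁exp]; exact hδup
  have hδlow' : Real.exp (-(10000 * t ^ 4)) < ‖periodForm S.L (v₁.1, v₁.2.1, v₁.2.2)‖ := by
    have e : (10 * t) ^ 4 = 10000 * t ^ 4 := by ring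
    rw [e] at hδlow; exact hδlow
  have hεup' : ‖periodForm S.L (v₂.1, v₂.2.1, v₂.2.2)‖ < Real.exp (-t ^ 33) := by
    rw [Real.exp_neg, ← hX₂]; exact hεup
  have hε1 : ‖periodForm S.L (v₂.1, v₂.2.1, v₂.2.2)‖ ≤ 1 :=
    (hεup'.trans_le (Real.exp_le_one_iff.mpr (by simp [pow_nonneg ht0]))).le
  -- sizes from the heights
  obtain ⟨hgA, -, hgC⟩ := abs_le_hgt v₁
  obtain ⟨-, -, hgF⟩ := abs_le_hgt v₂
  have hA : |(v₁.1 : ℝ)| ≤ c₂ * Real.exp (20 * t) := by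
    rw [← hX₁sq]; exact ((by exact_mod_cast hgA : |(v₁.1 : ℝ)| ≤ hgt v₁).trans hH₁.le)
  have hC : |(v₁.2.2 : ℝ)| ≤ c₂ * Real.exp (20 * t) := by
    rw [← hX₁sq]; exact ((by exact_mod_cast hgC : |(v₁.2.2 : ℝ)| ≤ hgt v₁).trans hH₁.le)
  have hFup : |(v₂.2.2 : ℝ)| ≤ c₂ * Real.exp (2 * t ^ 33) := by
    rw [← hX₂sq]; exact ((by exact_mod_cast hgF : |(v₂.2.2 : ℝ)| ≤ hgt v₂).trans hH₂.le)
  have hFlow : c₃ * Real.exp (t ^ 8) ≤ |(v₂.2.2 : ℝ)| := by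
    have h1 : Real.exp (t ^ 8) ≤ Real.exp ((t ^ 33) ^ (1 / 4 : ℝ)) := Real.exp_le_exp.mpr (rpow_quarter_pow33_ge ht1)
    have h2 : c₃ * Real.exp (t ^ 8) ≤ c₃ * (hgt v₂ : ℝ) := mul_le_mul_of_nonneg_left (h1.trans hH₂low.le) hc₃.le
    linarith
  have hFne : v₂.2.2 ≠ 0 := by
    intro h0
    rw [h0] at hF
    simp only [Int.cast_zero, abs_zero] at hF
    have : 0 < c₃ * (hgt v₂ : ℝ) := mul_pos hc₃ (by exact_mod_cast one_le_hgt hv₂0)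
    linarith
  -- `Δ`
  have hΔge' := hΔge v₂.1 v₂.2.1 v₂.2.2 hFne hε1
  -- `N` versus the constants
  have h10ρ : 0 ≤ 10 / (‖S.L.ω₁ * S.L.ω₂‖ * d.ρ) := by positivity
  have hNρ : 10 / (‖S.L.ω₁ * S.L.ω₂‖ * d.ρ) ≤ (N : ℝ) := by linarith [Real.exp_pos T₀]
  have hNK : 42 * PtData.Kη d K ≤ (N : ℝ) := by linarith [Real.exp_pos T₀]
  have hN21 : (21 : ℝ) ≤ N := by linarith [Real.exp_pos T₀]
  -- apply the assembled bound and simplify the constant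
  have hmain := PtData.coeff_bound_of_data ⟨d, N, v₁.1, v₁.2.1, v₁.2.2, v₂.1, v₂.2.1, v₂.2.2, hN1, hδne'⟩ K
    hc₂ hc₃ hcΔ ht14 hNexp hN2 hNρ hNK hN21 hδup' hδlow' hεup' hA hC hFup hFlow hΔge' hta₁ hta₂ hta₃ hta₄
    p hM0 hφ hi hj hl
  exact hmain.trans (final_const_bound hN2 hKX1 hM0)

end

end Literature.NumberTheory.Transcendental.Masser1975
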